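import Literature.AlgebraicGeometry.Surfaces.K3LatticeInvariants
import Literature.AlgebraicGeometry.Surfaces.K3HodgeTypesHolds
import Literature.AlgebraicGeometry.HodgeTheory.HypersurfaceHolomorphicFormsProofs
import Literature.AlgebraicGeometry.HodgeTheory.HodgeFiltrationModelsReductionProofs
import Literature.AlgebraicGeometry.HodgeTheory.FubiniStudyClassRational
import Literature.AlgebraicGeometry.HodgeTheory.RationalLatticeIntegral
import Literature.Geometry.Manifold.DeRhamFundamentalClassPairing
import Literature.NumberTheory.Transcendental.DeRhamTheoremMultiplicative
import Literature.Geometry.Symplectic.ComplexHomologicalOrientation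
import HarnessLib

/-!
# The complex orientation of a K3 surface: Hodge–Riemann positivity on `H^{2,0}` and an integral ample class — proofs

Family `hodge`, layer `Literature/AlgebraicGeometry/Surfaces`. Theorems-only companion (D-0026: no
definition, no named fact) of `K3LatticeInvariants.lean`, whose named fact
`K3_exists_orientation_signature_hodgeRiemann_ample` bundles, for every K3 surface `S/ℂ` and ONE
`ℤ`-orientation `μ` of the closed `4`-manifold `S(ℂ)` (the complex one), three printed statements:
(i) the intersection form has index `−16` (Huybrechts, *Lectures on K3 Surfaces*, Ch. 1, proof of
Prop. 3.5, p. 24: Thom–Hirzebruch; Milnor–Stasheff Thm. 19.4); (ii) the Hodge–Riemann positivity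
`(σ.σ̄) > 0` on `H^{2,0}` (Huybrechts Ch. 6 Prop. 1.2 (ii); Voisin I §6.3.2); (iii) an integral
`(1,1)`-class of positive square (an ample class, Huybrechts Ch. 1 §2.2, §3, Prop. 3.2). (The sibling
file `K3LatticeInvariantsProofs.lean` treats `b₂ = 22`.)

## What is proved here

* `IsK3Surface.exists_orientation_hodgeRiemann_ample` — **clauses (ii) AND (iii), for one and the
  same orientation of `S(ℂ)`, for every K3 surface `S`.** With
  `K3_exists_orientation_signature_hodgeRiemann_ample_of_signature` the named fact is thereby
  REDUCED TO CLAUSE (i) for the orientations satisfying (ii) (Hirzebruch's index theorem for the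
  complex orientation), the one input absent from the tree.
* `IsK3Surface.exists_orientation_hodgeRiemann_kaehler` — the engine: on a Hodge model `A` of `S`
  carrying the nowhere-vanishing holomorphic `2`-form `η` of `IsK3Surface`, and for an ARBITRARY
  natural multiplicative real de Rham isomorphism family `e` (de Rham's theorem), there is an
  orientation `μ` with (a) the Hodge–Riemann positivity (ii) and (b) the Kähler positivity
  `⟨y, [S(ℂ)]_μ ⊗ 1⟩ > 0` for the class `y` of `e[ω ∧ ω]`, `ω` the Kähler form of any smooth Kähler
  metric on `A.carrier`. The printed proofs ("`∫ σ ∧ σ̄ > 0`", Huybrechts Ch. 3 §1.1 / Voisin I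
  §6.3.2; "`ωⁿ/n!` is the volume form", Voisin I Lemma 3.8) are followed on the tree's carriers:
  `μ` is the orientation for which `e[Re(η ∧ η̄)]` pairs positively with `[S(ℂ)]` — `Re(η ∧ η̄)` is a
  nowhere-vanishing real top form (`re_wedge_conj_apply_ne_zero`: `Re(η ∧ η̄)(e, ie) = −4|η(e)|²` from
  the tree's `Λ^{2,0} = ℂ · dz₁ ∧ dz₂`), hence not exact (Stokes,
  `kroneckerPairing_integrationDeRham_map_fundamentalClass_ne_zero`, through
  `exists_orientation_kroneckerPairing_pos`: the complex manifold `S^an`, re-charted on `ℝ⁴`, is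
  oriented by `isOrientable_of_isManifold_complex`), so its class under ANY isomorphism family pairs
  non-trivially with the fundamental class of any orientation (`H⁴(S(ℂ); ℝ) = ℝ · (g ⊗ 1)`,
  `eq_smul_ringChange_of_kroneckerPairing_eq_one`; `exists_orientation_kroneckerPairing_pos_of_family`).
  (a): `σ = t[η]` (`h^{2,0} = 1`: `Huybrechts_K3_hodgeTypes_H2_holds`; `[η] ≠ 0`:
  `Voisin2002_closedForm_top_zero_not_exact_holds`), read in the Hodge model whose de Rham comparison
  is `e ⊗ ℂ` (model independence `hodgePQ_independent_of_hodgeModel_holds`; multiplicativity gives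
  `[η] ∪ [η̄] = (e ⊗ ℂ)[η ∧ η̄]`, `complexifyFun_mk_wedge`, `conjClass_complexifyFun`), whose real part
  is `e[Re(η ∧ η̄)]`; graded commutativity finishes. (b): `Re(η ∧ η̄)` and `ω ∧ ω` are both POSITIVE
  on complex frames `(e₁, ie₁, e₂, ie₂)` (`re_wedge_conj_apply_complexFrame`; the tree's
  `wedge_self_apply_pos_of_compatible`), so every convex combination vanishes nowhere
  (`convex_re_wedge_conj_wedge_self_apply_ne_zero`) and the sign of the pairing is constant along
  the segment (`kroneckerPairing_fundamentalClass_pos_of_convex_of_family`).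
* (iii) in `IsK3Surface.exists_orientation_hodgeRiemann_ample` (Huybrechts Ch. 1 §2.2 / Prop. 3.2:
  the class of an ample line bundle; Voisin I Thm. 7.10: `[ω_FS|_S] = c₁(𝒪_S(1))`): the restricted
  Fubini–Study class `H` of a projective embedding, on the model `A` (`fubiniStudy_rational_of_hodgeModel`,
  the tree's `exists_fubiniStudy_rational` with the model prescribed), is a Kähler class
  (`isKaehlerClassVia_of_pullback_eq_fubiniStudyPullbackForm`), hence of type `(1,1)`
  (`IsKaehlerClassVia.isOfHodgeType_one_one`), a positive real multiple `r H` is rational, so some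
  integral `u` has `u ⊗ 1 = N r H` (`exists_nsmul_isIntegralClass_of_isRationalClass_holds`), and
  `⟨u ∪ u, [S(ℂ)]_μ⟩ = (N r)² ⟨e[ω ∧ ω], [S(ℂ)]_μ ⊗ 1⟩ > 0` by (b) (multiplicativity of `e`, of `⊗ 1`
  and of `φ^*`).
* `IsK3Surface.exists_orientation_hodgeRiemann_twoZero` — clause (ii) alone (through the integration
  isomorphism); `IsK3Surface.orientation_unique_of_hodgeRiemann_twoZero` — **the orientation of (ii)
  is unique** (of the two orientations `±ν` of the connected `S(ℂ)` at most one has the positivity):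
  clause (ii) pins "the complex orientation" of `S(ℂ)` homologically (Milnor–Stasheff §13 p. 151),
  which the tree so far did not track (module docstring of `Motives/ComplexPointsOrientation.lean`).

## What is NOT here (the remaining input of the discharge)

* (i) `τ = −16` for the complex orientation: the Thom–Hirzebruch signature theorem (Milnor–Stasheff
  Thm. 19.4, with `c₁² = 0`, `c₂ = 24`) or the Hodge index theorem WITH SIGN on `H^{1,1}_ℝ` (Voisin I
  Thm. 6.32/6.33 at `k = 2`) together with `b₂ = 22` (the sibling fact `K3_finrank_complexBetti_two`,
  Noether's formula); the tree has the signature theorem only as a hypothesis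
  (`Geometry/Symplectic/CanonicalClassSqAndAdjunctionReduction.lean`) and the Hodge index theorem
  only sign-free (`HodgeTheory/HodgeIndexSurface.lean`, `HodgeTheory/HardLefschetzHodgeRiemann.lean`).
  `K3_exists_orientation_signature_hodgeRiemann_ample_of_signature` is the exact residual statement.

## References

* [Huybrechts2016K3] D. Huybrechts, Lectures on K3 Surfaces (CUP 2016), Ch. 1 Prop. 3.5 and its
  proof (p. 24), §2.2, §3, Prop. 3.2; Ch. 3 §1.1; Ch. 6 Prop. 1.2 (ii).
* [VoisinHodgeI2002] C. Voisin, Hodge Theory and Complex Algebraic Geometry I (CUP 2002), §2.3.1,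
  §3.1.1 Lemma 3.3, §3.1.3 Lemma 3.8, §6.3.2 Thm. 6.32, Prop. 7.5, Cor. 7.6, §7.1.1, §7.1.2,
  §7.1.3 Thm. 7.10.
* [MilnorStasheff1974] J. Milnor, J. Stasheff, Characteristic Classes (1974), §13 p. 151, §19
  Thm. 19.4.
* [HatcherAT2002] A. Hatcher, Algebraic Topology (2002), §3.1 p. 198 and Thm. 3.2; §3.3 pp. 234–236,
  Thm. 3.26, Thm. 3.30.
* [LeeSmoothManifolds2013] J. M. Lee, Introduction to Smooth Manifolds, 2nd ed. (2013), Thm. 17.31,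
  Thm. 18.14.
* [McDuffSalamon2017] D. McDuff, D. Salamon, Introduction to Symplectic Topology, 3rd ed. (2017),
  §4.1 (4.1.3).
* [SerreGAGA1956] J.-P. Serre, GAGA, Ann. Inst. Fourier 6 (1956), §2 n°5.
-/

noncomputable section

open scoped Manifold ContDiff Topology
open CategoryTheory
open Literature.AlgebraicTopology.SingularHomology
open Literature.Topology.FourManifolds
open Literature.Geometry.Kaehler (MForm IsSmoothForm IsClosedForm closedSmoothForms deRhamCohomology)
open Literature.NumberTheory.Transcendental

namespace Literature.AlgebraicGeometry.Surfaces

/-! ### Part A: coefficient bookkeeping on a closed oriented manifold -/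

section Coefficients

open singularCochainComplex

/-- `(g ⊗_ℤ ℝ) ⊗_ℝ ℂ = g ⊗_ℤ ℂ` for an integral class `g` (change of rings is functorial in the
ring homomorphism; Hatcher §3.1 p. 198). [cite: HatcherAT2002, §3.1 p. 198] -/
theorem ofRealClass_ringChange_int {Y : Type} [TopologicalSpace Y] {k : ℕ}
    (g : singularCohomology ℤ ℤ Y k) :
    HodgeTheory.ofRealClass Y k (singularCohomology.ringChange (algebraMap ℤ ℝ) Y k g) =
      singularCohomology.ringChange (algebraMap ℤ ℂ) Y k g := by
  rw [HodgeTheory.ofRealClass_eq_ringChange]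
  induction g using singularCohomology_induction_on with
  | h u =>
    rw [singularCohomology.ringChange_π, singularCohomology.ringChange_π,
      singularCohomology.ringChange_π]
    congr 1
    refine coFn_injective ?_
    rw [coFn_cocyclesRingChange, coFn_cocyclesRingChange, coFn_cocyclesRingChange]
    funext σ
    simp

/-- **Real top classes of a closed connected oriented manifold are multiples of the Kronecker dual
of `[Y]`**: if `⟨g, [Y]_μ⟩ = 1` then every `y ∈ Hⁿ(Y; ℝ)` is `⟨y, [Y]_μ ⊗ 1⟩ • (g ⊗ 1)` (the line
`Hⁿ(Y; ℝ)` is detected by `[Y] ⊗ 1`, Hatcher Thm. 3.26 (a) with Thm. 3.2; the tree's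
`eq_zero_of_kroneckerPairing_coeffChange_fundamentalClass_eq_zero`).
[cite: HatcherAT2002, §3.3 Thm. 3.26 (a) and §3.1 Thm. 3.2] -/
theorem eq_smul_ringChange_of_kroneckerPairing_eq_one {n : ℕ} {Y : Type} [TopologicalSpace Y]
    [T2Space Y] [CompactSpace Y] [ConnectedSpace Y] [ChartedSpace (EuclideanSpace ℝ (Fin n)) Y]
    (μ : HomologicalOrientation ℤ Y n) {g : singularCohomology ℤ ℤ Y n}
    (hg : kroneckerPairing ℤ ℤ Y n g μ.fundamentalClass = 1) (y : singularCohomology ℝ ℝ Y n) :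
    y = kroneckerPairing ℝ ℝ Y n y
        (singularHomology.coeffChange Y (algebraMap ℤ ℝ : ℤ →+* ℝ).toAddMonoidHom n
          μ.fundamentalClass) •
      singularCohomology.ringChange (algebraMap ℤ ℝ) Y n g := by
  have h1 : kroneckerPairing ℝ ℝ Y n (singularCohomology.ringChange (algebraMap ℤ ℝ) Y n g)
      (singularHomology.coeffChange Y (algebraMap ℤ ℝ : ℤ →+* ℝ).toAddMonoidHom n
        μ.fundamentalClass) = 1 := by
    rw [Literature.Geometry.Manifold.kroneckerPairing_ringChange_coeffChange ℝ g μ.fundamentalClass,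
      hg, map_one]
  rw [← sub_eq_zero]
  apply Literature.Geometry.Manifold.eq_zero_of_kroneckerPairing_coeffChange_fundamentalClass_eq_zero
    ℝ μ
  rw [map_sub, LinearMap.sub_apply, map_smul, LinearMap.smul_apply, h1, smul_eq_mul, mul_one,
    sub_self]

end Coefficients

/-! ### Part B: the positive top form `Re(η ∧ η̄)` of a `(2,0)`-form on a complex surface -/

section Pointwise

variable {E : Type*} [NormedAddCommGroup E] [NormedSpace ℂ E] [FiniteDimensional ℂ E]
  {M : Type*} [TopologicalSpace M] [ChartedSpace E M]

/-- A continuous alternating map which vanishes after precomposition with a SURJECTIVE continuous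
linear map is zero. [folklore] -/
theorem continuousAlternatingMap_eq_zero_of_compContinuousLinearMap_eq_zero
    {𝕜 : Type*} [Semiring 𝕜] {V W G : Type*} [AddCommMonoid V] [Module 𝕜 V] [TopologicalSpace V]
    [AddCommMonoid W] [Module 𝕜 W] [TopologicalSpace W] [AddCommMonoid G] [Module 𝕜 G]
    [TopologicalSpace G] {ι : Type*} (φ : W [⋀^ι]→L[𝕜] G) {f : V →L[𝕜] W}
    (hf : Function.Surjective f) (h : φ.compContinuousLinearMap f = 0) : φ = 0 := by
  ext v
  choose w hw using fun i ↦ hf (v i)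
  have h1 := congrArg (fun ψ : V [⋀^ι]→L[𝕜] G ↦ ψ w) h
  simp only [ContinuousAlternatingMap.compContinuousLinearMap_apply,
    ContinuousAlternatingMap.coe_zero, Pi.zero_apply] at h1
  have hv : (f ∘ w) = v := funext hw
  rw [ContinuousAlternatingMap.coe_zero, Pi.zero_apply, ← hv]
  exact h1

/-- **`Re(η ∧ η̄)(e, ie) = -4 |η(e)|²` for a `(2,0)`-form `η` on a complex surface**, in a complex
basis `e = (e₁, e₂)` of the model space: pointwise `η = η(e) · dz₁ ∧ dz₂`
(`IsOfType.apply_eq_smul_cdetL`), `(a det) ∧ \overline{(a det)} = |a|² det ∧ \overline{det}` and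
`(det ∧ \overline{det})(e, ie) = (-2i)² = -4` (`wedge_cdetL_conj_apply_append`). Voisin I §2.3.1;
the pointwise positivity `∫ σ ∧ σ̄ > 0` of Huybrechts Ch. 6 Prop. 1.2 (ii).
[cite: VoisinHodgeI2002, §2.3.1] [cite: Huybrechts2016K3, Ch. 6 Prop. 1.2 (ii)] -/
theorem re_wedge_conj_apply_append (e : Module.Basis (Fin 2) ℂ E) {η : MForm 𝓘(ℝ, E) M ℂ 2}
    (hη : IsOfType 2 0 η) (x : M) :
    (η.wedge η.conj).re x (Fin.append e (fun j ↦ Complex.I • e j)) =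
      -4 * Complex.normSq (η x e) := by
  have hw := hη.apply_eq_smul_cdetL e x
  set a : ℂ := η x e with ha
  change (Complex.reCLM.compContinuousAlternatingMap
    ((η x : E [⋀^Fin 2]→L[ℝ] ℂ).wedge ((Complex.conjCLE : ℂ →L[ℝ] ℂ).compContinuousAlternatingMap
      (η x : E [⋀^Fin 2]→L[ℝ] ℂ)))) (Fin.append e (fun j ↦ Complex.I • e j)) = _
  rw [hw, conjCLE_compContinuousAlternatingMap_smul, wedge_smul_left_complex,
    wedge_smul_right_complex, smul_smul, ContinuousLinearMap.compContinuousAlternatingMap_coe,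
    Function.comp_apply, ContinuousAlternatingMap.smul_apply, wedge_cdetL_conj_apply_append,
    Complex.reCLM_apply, Complex.mul_conj, smul_eq_mul]
  have hI : (-2 * Complex.I) ^ 2 = -4 := by
    rw [mul_pow, Complex.I_sq]; norm_num
  rw [hI]
  simp [Complex.mul_re]
  ring

/-- **`Re(η ∧ η̄)` vanishes nowhere where `η` does not** (a `(2,0)`-form on a complex surface):
`Re(η ∧ η̄)(e, ie) = -4|η(e)|² ≠ 0`. [cite: VoisinHodgeI2002, §2.3.1]
[cite: Huybrechts2016K3, Ch. 6 Prop. 1.2 (ii)] -/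
theorem re_wedge_conj_apply_ne_zero (hE : Module.finrank ℂ E = 2) {η : MForm 𝓘(ℝ, E) M ℂ 2}
    (hη : IsOfType 2 0 η) {x : M} (hx : η x ≠ 0) : (η.wedge η.conj).re x ≠ 0 := by
  obtain ⟨e⟩ : Nonempty (Module.Basis (Fin 2) ℂ E) := ⟨Module.finBasisOfFinrankEq ℂ E hE⟩
  have hw := hη.apply_eq_smul_cdetL e x
  have ha0 : η x e ≠ 0 := fun h0 ↦ hx (by
    have h1 : (η x : E [⋀^Fin 2]→L[ℝ] ℂ) = 0 := by rw [hw, h0]; exact zero_smul ℂ _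
    exact h1)
  intro h0
  have key := re_wedge_conj_apply_append e hη x
  rw [h0] at key
  have : (-4 : ℝ) * Complex.normSq (η x e) ≠ 0 :=
    mul_ne_zero (by norm_num) (Complex.normSq_pos.2 ha0).ne'
  exact this key.symm

/-- **`Re(η ∧ η̄)` is POSITIVE on complex frames `(e₁, ie₁, e₂, ie₂)`**: its value there is
`4|η(e₁, e₂)|²` (one transposition away from `(e₁, e₂, ie₁, ie₂)`, where it is `−4|η(e)|²`). This is
the pointwise positivity `σ ∧ σ̄ > 0` for the complex orientation (Huybrechts Ch. 6 Prop. 1.2 (ii);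
Voisin I §2.3.1). [cite: VoisinHodgeI2002, §2.3.1] [cite: Huybrechts2016K3, Ch. 6 Prop. 1.2 (ii)] -/
theorem re_wedge_conj_apply_complexFrame (e : Module.Basis (Fin 2) ℂ E) {η : MForm 𝓘(ℝ, E) M ℂ 2}
    (hη : IsOfType 2 0 η) (x : M) :
    (η.wedge η.conj).re x ![e 0, (Complex.I • e 0 : E), e 1, (Complex.I • e 1 : E)] =
      4 * Complex.normSq (η x e) := by
  have h := re_wedge_conj_apply_append e hη x
  have hF : (![e 0, (Complex.I • e 0 : E), e 1, (Complex.I • e 1 : E)] : Fin 4 → E) =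
      Fin.append e (fun j ↦ Complex.I • e j) ∘ Equiv.swap (1 : Fin 4) 2 := by
    funext i
    fin_cases i <;> rfl
  -- read both statements on `E`-valued frames (`TangentSpace 𝓘(ℝ, E) x = E` definitionally)
  have key : ((η.wedge η.conj).re x : E [⋀^Fin (2 + 2)]→L[ℝ] ℝ)
      (![e 0, (Complex.I • e 0 : E), e 1, (Complex.I • e 1 : E)] : Fin 4 → E) =
        4 * Complex.normSq (η x e) := by
    have hsw := ((η.wedge η.conj).re x : E [⋀^Fin (2 + 2)]→L[ℝ] ℝ).toAlternatingMap.map_swap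
      (Fin.append e (fun j ↦ Complex.I • e j)) (by decide : (1 : Fin 4) ≠ 2)
    simp only [ContinuousAlternatingMap.coe_toAlternatingMap] at hsw
    have h' : ((η.wedge η.conj).re x : E [⋀^Fin (2 + 2)]→L[ℝ] ℝ)
        (Fin.append e (fun j ↦ Complex.I • e j)) = -4 * Complex.normSq (η x e) := h
    rw [hF]
    refine hsw.trans ?_
    rw [h']
    ring
  exact key

omit [FiniteDimensional ℂ E] in
/-- The real frame `(e₁, ie₁, e₂, ie₂)` of a complex basis `(e₁, e₂)` is `ℝ`-linearly independent.
[folklore] -/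
theorem linearIndependent_complexFrame (e : Module.Basis (Fin 2) ℂ E) :
    LinearIndependent ℝ ![e 0, (Complex.I • e 0 : E), e 1, (Complex.I • e 1 : E)] := by
  rw [Fintype.linearIndependent_iff]
  intro c hc
  have h2 := Fintype.linearIndependent_iff.1 e.linearIndependent
    ![(c 0 : ℂ) + (c 1 : ℂ) * Complex.I, (c 2 : ℂ) + (c 3 : ℂ) * Complex.I] (by
      rw [Fin.sum_univ_two]
      rw [Fin.sum_univ_four] at hc
      simp only [Matrix.cons_val_zero, Matrix.cons_val_one, Matrix.cons_val] at hc ⊢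
      rw [add_smul, add_smul, mul_smul, mul_smul, Complex.coe_smul, Complex.coe_smul,
        Complex.coe_smul, Complex.coe_smul]
      simpa only [add_assoc] using hc)
  have h0 := h2 0
  have h1 := h2 1
  simp only [Matrix.cons_val_zero, Matrix.cons_val_one] at h0 h1
  have h0re := congrArg Complex.re h0
  have h0im := congrArg Complex.im h0
  have h1re := congrArg Complex.re h1
  have h1im := congrArg Complex.im h1
  simp only [Complex.add_re, Complex.ofReal_re, Complex.mul_re, Complex.I_re, mul_zero,
    Complex.ofReal_im, Complex.I_im, sub_zero, add_zero, Complex.zero_re, Complex.add_im,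
    Complex.mul_im, mul_one, zero_add, Complex.zero_im] at h0re h0im h1re h1im
  intro i
  fin_cases i
  · exact h0re
  · exact h0im
  · exact h1re
  · exact h1im

/-- **A convex combination of `Re(η ∧ η̄)` and `κ ∧ κ` vanishes nowhere**, for `η` a `(2,0)`-form
vanishing nowhere and `κ` a real `J`-invariant positive `2`-form (`κ(v, Jv) > 0`, `κ(Jv, Jw) = κ(v, w)`:
the Kähler form of a Hermitian metric, Voisin I §3.1.1 Lemma 3.3): both are positive on every complex
frame `(e₁, ie₁, e₂, ie₂)` (`re_wedge_conj_apply_complexFrame`; and the tree's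
`Literature.Geometry.Symplectic.wedge_self_apply_pos_of_compatible`, the Cauchy–Schwarz computation
`(κ ∧ κ)(e, Je, f, Jf) > 0`). [cite: VoisinHodgeI2002, §3.1.1 Lemma 3.3 and §2.3.1] -/
theorem convex_re_wedge_conj_wedge_self_apply_ne_zero (hE : Module.finrank ℂ E = 2)
    {η : MForm 𝓘(ℝ, E) M ℂ 2} (hη : IsOfType 2 0 η) {κ : MForm 𝓘(ℝ, E) M ℝ 2}
    (hκpos : ∀ (x : M) (v : TangentSpace 𝓘(ℝ, E) x), v ≠ 0 →
      0 < κ x ![v, Literature.Geometry.Kaehler.tangentJ E x v])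
    (hκJ : ∀ (x : M) (v w : TangentSpace 𝓘(ℝ, E) x),
      κ x ![Literature.Geometry.Kaehler.tangentJ E x v, Literature.Geometry.Kaehler.tangentJ E x w] =
        κ x ![v, w])
    {x : M} (hx : η x ≠ 0) {t : ℝ} (ht : t ∈ Set.Icc (0 : ℝ) 1) :
    ((1 - t) • (η.wedge η.conj).re + t • κ.wedge κ) x ≠ 0 := by
  obtain ⟨e⟩ : Nonempty (Module.Basis (Fin 2) ℂ E) := ⟨Module.finBasisOfFinrankEq ℂ E hE⟩
  have hw := hη.apply_eq_smul_cdetL e x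
  have ha0 : η x e ≠ 0 := fun h0 ↦ hx (by
    have h1 : (η x : E [⋀^Fin 2]→L[ℝ] ℂ) = 0 := by rw [hw, h0]; exact zero_smul ℂ _
    exact h1)
  -- both forms are positive on the complex frame `(e₁, ie₁, e₂, ie₂)`
  have h₀ : 0 < (η.wedge η.conj).re x ![e 0, (Complex.I • e 0 : E), e 1, (Complex.I • e 1 : E)] :=
    lt_of_lt_of_eq (mul_pos (by norm_num) (Complex.normSq_pos.2 ha0))
      (re_wedge_conj_apply_complexFrame e hη x).symm
  have h₁ : 0 < (κ.wedge κ) x ![e 0, (Complex.I • e 0 : E), e 1, (Complex.I • e 1 : E)] := by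
    have h := Literature.Geometry.Symplectic.wedge_self_apply_pos_of_compatible (V := E) (κ x)
      (Literature.Geometry.Kaehler.tangentJ E x) (Literature.Geometry.Kaehler.tangentJ_tangentJ x)
      (hκpos x) (hκJ x) (e := e 0) (f := e 1) (linearIndependent_complexFrame e)
    rw [MForm.wedge_apply]
    exact h
  intro h0
  -- evaluate the vanishing combination on the frame (pointwise operations, definitionally)
  have hval : (1 - t) * (η.wedge η.conj).re x ![e 0, (Complex.I • e 0 : E), e 1, (Complex.I • e 1 : E)] +
      t * (κ.wedge κ) x ![e 0, (Complex.I • e 0 : E), e 1, (Complex.I • e 1 : E)] = 0 :=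
    congrArg (fun φ : E [⋀^Fin (2 + 2)]→L[ℝ] ℝ ↦
      φ (![e 0, (Complex.I • e 0 : E), e 1, (Complex.I • e 1 : E)] : Fin 4 → E)) h0
  obtain ⟨ht0, ht1⟩ := ht
  have hpos : 0 < (1 - t) * (η.wedge η.conj).re x ![e 0, (Complex.I • e 0 : E), e 1, (Complex.I • e 1 : E)] +
      t * (κ.wedge κ) x ![e 0, (Complex.I • e 0 : E), e 1, (Complex.I • e 1 : E)] := by
    rcases eq_or_lt_of_le ht1 with rfl | hlt
    · rw [sub_self, zero_mul, one_mul, zero_add]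
      exact h₁
    · exact add_pos_of_pos_of_nonneg (mul_pos (by linarith) h₀) (mul_nonneg ht0 h₁.le)
  exact hpos.ne' hval

end Pointwise

/-! ### Part C: an orientation of `X(ℂ)` positive on a given nowhere-vanishing top form of `X^an` -/

section Orientation

open Literature.Geometry.Manifold

variable {n : ℕ} {X : Motives.SchemeOver ℂ}

/-- **Transport of the orientation question to de Rham positivity.** Let `X` be smooth projective of
dimension `n`, `A` a Hodge model (`φ : X^an → X(ℂ)` the analytification) and `ρ` a closed smooth
real `2n`-form on `X^an` vanishing nowhere. Then there is a `ℤ`-orientation `μ` of the closed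
`2n`-manifold `X(ℂ)` such that the class `y ∈ H²ⁿ(X(ℂ); ℝ)` with `φ^* y = e[ρ]` (`e` the integration
isomorphism of de Rham's theorem) has `⟨y, [X(ℂ)]_μ ⊗ 1⟩ > 0`. Proof: re-chart `X^an` on `ℝ²ⁿ`
(`Recharted`), orient it (complex manifolds are orientable, `Motives.isOrientable_of_isManifold_complex`,
`isOrientableOver_int_of_isOrientable_holds`), observe `⟨e[ρ], [X^an] ⊗ 1⟩ ≠ 0`
(`kroneckerPairing_integrationDeRham_map_fundamentalClass_ne_zero`: a nowhere-vanishing top form is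
not exact, Stokes), flip the orientation if necessary (`fundamentalClass_neg_holds`) and transport it
along the homeomorphism `φ` (`fundamentalClass_comap_holds`). This is the homological shadow of "a
complex manifold is canonically oriented" (Milnor–Stasheff §13 p. 151; Voisin I §11.1.2), in the
sign-decidable form the tree allows. [cite: MilnorStasheff1974, §13 p. 151]
[cite: LeeSmoothManifolds2013, Thm. 17.31 and Thm. 18.14] [cite: HatcherAT2002, §3.3 p. 236] -/
theorem exists_orientation_kroneckerPairing_pos (hX : Motives.IsSmoothProjective n X)
    (A : HodgeTheory.HodgeModel n X) {ρ : MForm 𝓘(ℝ, A.model) A.carrier ℝ (2 * n)}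
    (hρ : ρ ∈ closedSmoothForms 𝓘(ℝ, A.model) A.carrier ℝ (2 * n)) (hne : ∀ x, ρ x ≠ 0) :
    ∃ μ : HomologicalOrientation ℤ (Motives.ComplexPoints X) (2 * n),
      ∀ y : singularCohomology ℝ ℝ (Motives.ComplexPoints X) (2 * n),
        singularCohomology.map ℝ ℝ
            ⟨A.toComplexPoints, A.isAnalytification.isHomeomorph.continuous⟩ (2 * n) y =
          integrationDeRhamIsoFamily A.model A.carrier (2 * n) (deRhamCohomology.mk ⟨ρ, hρ⟩) →
        0 < kroneckerPairing ℝ ℝ (Motives.ComplexPoints X) (2 * n) y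
          (singularHomology.coeffChange (Motives.ComplexPoints X)
            (algebraMap ℤ ℝ : ℤ →+* ℝ).toAddMonoidHom (2 * n) μ.fundamentalClass) := by
  classical
  letI := hX.chartedSpace
  haveI := Motives.ComplexPoints.compactSpace_of_isSmoothProjective hX
  haveI := Motives.ComplexPoints.t2Space_of_isSmoothProjective hX
  haveI := HodgeTheory.connectedSpace_complexPoints hX
  have hφ := A.isAnalytification
  haveI : CompactSpace A.carrier := A.compactSpace_carrier hX
  haveI : ConnectedSpace A.carrier :=
    hφ.homeomorph.symm.surjective.connectedSpace hφ.homeomorph.symm.continuous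
  -- re-chart `X^an` on `ℝ²ⁿ`
  have hfinℝ : Module.finrank ℝ A.model = 2 * n := by
    rw [finrank_real_of_complex, hφ.finrank_eq]
  let L : A.model ≃L[ℝ] EuclideanSpace ℝ (Fin (2 * n)) :=
    ContinuousLinearEquiv.ofFinrankEq (by rw [hfinℝ, finrank_euclideanSpace_fin])
  haveI : CompactSpace (Recharted A.carrier L) := ‹CompactSpace A.carrier›
  have hM : IsOrientable 𝓘(ℝ, A.model) A.carrier := Motives.isOrientable_of_isManifold_complex
  have hR : IsOrientable (𝓡 (2 * n)) (Recharted A.carrier L) := ⟨(Classical.choice hM).recharted L⟩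
  obtain ⟨μR⟩ := isOrientableOver_int_of_isOrientable_holds (Recharted A.carrier L) hR
  -- the identity `f : Recharted → X^an` is smooth with invertible differential
  have hf : ContMDiff (𝓡 (2 * n)) 𝓘(ℝ, A.model) ∞
      ((Recharted.of L).symm : Recharted A.carrier L → A.carrier) := Recharted.contMDiff_of_symm L
  have hne' : ∀ y, ρ.pullback (𝓡 (2 * n)) ((Recharted.of L).symm) y ≠ 0 := by
    intro y h0
    apply hne ((Recharted.of L).symm y)
    have hs : Function.Surjective
        (mfderiv (𝓡 (2 * n)) 𝓘(ℝ, A.model) ((Recharted.of L).symm : Recharted A.carrier L → A.carrier) y) :=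
      ((Recharted.diffeomorph L).symm.mfderivToContinuousLinearEquiv (by norm_num) y).surjective
    exact continuousAlternatingMap_eq_zero_of_compContinuousLinearMap_eq_zero
      (ρ ((Recharted.of L).symm y)) hs h0
  -- `⟨e[ρ], f_* ([R] ⊗ 1)⟩ ≠ 0`, and `> 0` for one of the two orientations `±μR`
  have hr := kroneckerPairing_integrationDeRham_map_fundamentalClass_ne_zero μR hf ⟨ρ, hρ⟩ hne'
  obtain ⟨μR', hpos⟩ : ∃ μR' : HomologicalOrientation ℤ (Recharted A.carrier L) (2 * n),
      0 < kroneckerPairing ℝ ℝ A.carrier (2 * n)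
        (integrationDeRhamIsoFamily A.model A.carrier (2 * n) (deRhamCohomology.mk ⟨ρ, hρ⟩))
        (singularHomology.map ℝ ℝ ⟨(Recharted.of L).symm, hf.continuous⟩ (2 * n)
          (singularHomology.coeffChange (Recharted A.carrier L)
            (algebraMap ℤ ℝ : ℤ →+* ℝ).toAddMonoidHom (2 * n) μR'.fundamentalClass)) := by
    rcases lt_or_gt_of_ne hr with h | h
    · refine ⟨-μR, ?_⟩
      rw [HomologicalOrientation.fundamentalClass_neg_holds (R := ℤ) (X := Recharted A.carrier L) (2 * n) μR,
        map_neg, map_neg, map_neg]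
      linarith
    · exact ⟨μR, h⟩
  -- transport to `X(ℂ)` along `ψ : X(ℂ) ≃ₜ Recharted X^an`
  let ψ : Motives.ComplexPoints X ≃ₜ Recharted A.carrier L :=
    hφ.homeomorph.symm.trans (Recharted.ofHomeomorph L)
  refine ⟨μR'.comap ψ, fun y hy ↦ ?_⟩
  have hfc : (μR'.comap ψ).fundamentalClass =
      singularHomology.map ℤ ℤ (ψ.symm : C(Recharted A.carrier L, Motives.ComplexPoints X)) (2 * n)
        μR'.fundamentalClass := by
    rw [HomologicalOrientation.fundamentalClass_comap_holds (R := ℤ) (X := Recharted A.carrier L)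
      (Y := Motives.ComplexPoints X) (2 * n) μR' ψ, singularHomology.mapIso_inv]
  have hψ : (ψ.symm : C(Recharted A.carrier L, Motives.ComplexPoints X)) =
      (⟨A.toComplexPoints, A.isAnalytification.isHomeomorph.continuous⟩ :
        C(A.carrier, Motives.ComplexPoints X)).comp ⟨(Recharted.of L).symm, hf.continuous⟩ := by
    ext x; rfl
  rw [hfc, singularHomology.coeffChange_map, ← kroneckerPairing_map, hψ,
    singularCohomology.map_comp, ModuleCat.comp_apply, hy, kroneckerPairing_map]
  exact hpos

/-- **A nowhere-vanishing closed real top form of `X^an` is not exact** (Stokes: its class pairs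
non-trivially with the fundamental class for the orientation of
`exists_orientation_kroneckerPairing_pos`). [cite: LeeSmoothManifolds2013, Thm. 17.31 and Thm. 18.14] -/
theorem deRhamCohomology_mk_ne_zero_of_forall_ne_zero (hX : Motives.IsSmoothProjective n X)
    (A : HodgeTheory.HodgeModel n X) {ρ : MForm 𝓘(ℝ, A.model) A.carrier ℝ (2 * n)}
    (hρ : ρ ∈ closedSmoothForms 𝓘(ℝ, A.model) A.carrier ℝ (2 * n)) (hne : ∀ x, ρ x ≠ 0) :
    deRhamCohomology.mk ⟨ρ, hρ⟩ ≠ 0 := by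
  intro h0
  obtain ⟨μ, hμ⟩ := exists_orientation_kroneckerPairing_pos hX A hρ hne
  have h := hμ 0 (by rw [map_zero, h0, map_zero])
  rw [map_zero, LinearMap.zero_apply] at h
  exact lt_irrefl _ h

/-- **A non-zero real top class of `X(ℂ)` pairs non-trivially with `[X(ℂ)]_μ ⊗ 1`, for every
orientation `μ`**: `y = ⟨y, [X(ℂ)]_μ ⊗ 1⟩ • (g ⊗ 1)` for the Kronecker dual `g` of `[X(ℂ)]_μ`
(`exists_integral_orientation_generator_top`, `eq_smul_ringChange_of_kroneckerPairing_eq_one`).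
[cite: HatcherAT2002, §3.3 Thm. 3.26 (a) and Thm. 3.30] -/
theorem kroneckerPairing_fundamentalClass_ne_zero_of_ne_zero (hX : Motives.IsSmoothProjective n X)
    (μ : HomologicalOrientation ℤ (Motives.ComplexPoints X) (2 * n))
    {y : singularCohomology ℝ ℝ (Motives.ComplexPoints X) (2 * n)} (hy : y ≠ 0) :
    kroneckerPairing ℝ ℝ (Motives.ComplexPoints X) (2 * n) y
        (singularHomology.coeffChange (Motives.ComplexPoints X)
          (algebraMap ℤ ℝ : ℤ →+* ℝ).toAddMonoidHom (2 * n) μ.fundamentalClass) ≠ 0 := by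
  letI := hX.chartedSpace
  haveI := Motives.ComplexPoints.compactSpace_of_isSmoothProjective hX
  haveI := Motives.ComplexPoints.t2Space_of_isSmoothProjective hX
  haveI := HodgeTheory.connectedSpace_complexPoints hX
  obtain ⟨g, hg1, -⟩ := exists_integral_orientation_generator_top hX μ
  intro h0
  apply hy
  rw [eq_smul_ringChange_of_kroneckerPairing_eq_one μ hg1 y, h0, zero_smul]

/-- **For EVERY orientation `μ` of `X(ℂ)` and EVERY real de Rham isomorphism family `e`, a
nowhere-vanishing closed real top form `ρ` of `X^an` gives a class `y`, `φ^* y = e[ρ]`, pairing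
non-trivially with `[X(ℂ)]_μ`** (`[ρ] ≠ 0` by Stokes, `e` and `φ^*` are injective, and the real
line `H²ⁿ(X(ℂ); ℝ)` is detected by `[X(ℂ)] ⊗ 1`). [cite: LeeSmoothManifolds2013, Thm. 17.31]
[cite: HatcherAT2002, §3.3 Thm. 3.26 (a)] -/
theorem kroneckerPairing_fundamentalClass_ne_zero_of_family (hX : Motives.IsSmoothProjective n X)
    (A : HodgeTheory.HodgeModel n X) (e : DeRhamIsoFamily 𝓘(ℝ, A.model))
    {ρ : MForm 𝓘(ℝ, A.model) A.carrier ℝ (2 * n)}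
    (hρ : ρ ∈ closedSmoothForms 𝓘(ℝ, A.model) A.carrier ℝ (2 * n)) (hne : ∀ x, ρ x ≠ 0)
    (μ : HomologicalOrientation ℤ (Motives.ComplexPoints X) (2 * n))
    {y : singularCohomology ℝ ℝ (Motives.ComplexPoints X) (2 * n)}
    (hy : singularCohomology.map ℝ ℝ
        ⟨A.toComplexPoints, A.isAnalytification.isHomeomorph.continuous⟩ (2 * n) y =
      e A.carrier (2 * n) (deRhamCohomology.mk ⟨ρ, hρ⟩)) :
    kroneckerPairing ℝ ℝ (Motives.ComplexPoints X) (2 * n) y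
        (singularHomology.coeffChange (Motives.ComplexPoints X)
          (algebraMap ℤ ℝ : ℤ →+* ℝ).toAddMonoidHom (2 * n) μ.fundamentalClass) ≠ 0 := by
  haveI : CompactSpace A.carrier := A.compactSpace_carrier hX
  refine kroneckerPairing_fundamentalClass_ne_zero_of_ne_zero hX μ fun h0 ↦ ?_
  rw [h0, map_zero] at hy
  exact deRhamCohomology_mk_ne_zero_of_forall_ne_zero hX A hρ hne
    ((LinearEquiv.map_eq_zero_iff _).1 hy.symm)

/-- **Deformation invariance of the sign, for an arbitrary real de Rham isomorphism family `e`.**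
If two closed smooth real top forms `ρ₀`, `ρ₁` of `X^an` have all convex combinations
`(1 − t)ρ₀ + tρ₁`, `t ∈ [0, 1]`, nowhere vanishing, then for every orientation `μ` of `X(ℂ)` the
classes `yᵢ` with `φ^* yᵢ = e[ρᵢ]` pair with `[X(ℂ)]_μ ⊗ 1` with the SAME sign (the pairing of
`(1 − t)ρ₀ + tρ₁` is affine in `t` and never zero on `[0, 1]`,
`kroneckerPairing_fundamentalClass_ne_zero_of_family`). [cite: LeeSmoothManifolds2013, Thm. 17.31 and Thm. 18.14] -/
theorem kroneckerPairing_fundamentalClass_pos_of_convex_of_family (hX : Motives.IsSmoothProjective n X)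
    (A : HodgeTheory.HodgeModel n X) (e : DeRhamIsoFamily 𝓘(ℝ, A.model))
    {ρ₀ ρ₁ : MForm 𝓘(ℝ, A.model) A.carrier ℝ (2 * n)}
    (h₀ : ρ₀ ∈ closedSmoothForms 𝓘(ℝ, A.model) A.carrier ℝ (2 * n))
    (h₁ : ρ₁ ∈ closedSmoothForms 𝓘(ℝ, A.model) A.carrier ℝ (2 * n))
    (hne : ∀ t ∈ Set.Icc (0 : ℝ) 1, ∀ x, ((1 - t) • ρ₀ + t • ρ₁) x ≠ 0)
    (μ : HomologicalOrientation ℤ (Motives.ComplexPoints X) (2 * n))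
    {y₀ y₁ : singularCohomology ℝ ℝ (Motives.ComplexPoints X) (2 * n)}
    (hy₀ : singularCohomology.map ℝ ℝ
        ⟨A.toComplexPoints, A.isAnalytification.isHomeomorph.continuous⟩ (2 * n) y₀ =
      e A.carrier (2 * n) (deRhamCohomology.mk ⟨ρ₀, h₀⟩))
    (hy₁ : singularCohomology.map ℝ ℝ
        ⟨A.toComplexPoints, A.isAnalytification.isHomeomorph.continuous⟩ (2 * n) y₁ =
      e A.carrier (2 * n) (deRhamCohomology.mk ⟨ρ₁, h₁⟩))
    (hpos : 0 < kroneckerPairing ℝ ℝ (Motives.ComplexPoints X) (2 * n) y₀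
        (singularHomology.coeffChange (Motives.ComplexPoints X)
          (algebraMap ℤ ℝ : ℤ →+* ℝ).toAddMonoidHom (2 * n) μ.fundamentalClass)) :
    0 < kroneckerPairing ℝ ℝ (Motives.ComplexPoints X) (2 * n) y₁
        (singularHomology.coeffChange (Motives.ComplexPoints X)
          (algebraMap ℤ ℝ : ℤ →+* ℝ).toAddMonoidHom (2 * n) μ.fundamentalClass) := by
  haveI : CompactSpace A.carrier := A.compactSpace_carrier hX
  set z := singularHomology.coeffChange (Motives.ComplexPoints X)
    (algebraMap ℤ ℝ : ℤ →+* ℝ).toAddMonoidHom (2 * n) μ.fundamentalClass with hz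
  set a := kroneckerPairing ℝ ℝ (Motives.ComplexPoints X) (2 * n) y₀ z with ha
  set b := kroneckerPairing ℝ ℝ (Motives.ComplexPoints X) (2 * n) y₁ z with hb
  by_contra hlt
  have hle : b ≤ 0 := not_lt.1 hlt
  have hb0 : b ≠ 0 :=
    kroneckerPairing_fundamentalClass_ne_zero_of_family hX A e h₁
      (fun x ↦ by simpa using hne 1 ⟨zero_le_one, le_rfl⟩ x) μ hy₁
  have hneg : b < 0 := lt_of_le_of_ne hle hb0
  -- the parameter where the affine function `(1 - t) a + t b` vanishes
  set t := a / (a - b) with ht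
  have hab : 0 < a - b := by linarith
  have ht0 : 0 ≤ t := div_nonneg hpos.le hab.le
  have ht1 : t ≤ 1 := (div_le_one hab).2 (by linarith)
  have hmem : (1 - t) • ρ₀ + t • ρ₁ ∈ closedSmoothForms 𝓘(ℝ, A.model) A.carrier ℝ (2 * n) :=
    Submodule.add_mem _ (Submodule.smul_mem _ _ h₀) (Submodule.smul_mem _ _ h₁)
  have hsub : (⟨(1 - t) • ρ₀ + t • ρ₁, hmem⟩ : closedSmoothForms 𝓘(ℝ, A.model) A.carrier ℝ (2 * n)) =
      (1 - t) • ⟨ρ₀, h₀⟩ + t • ⟨ρ₁, h₁⟩ := rfl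
  have hyt : singularCohomology.map ℝ ℝ
        ⟨A.toComplexPoints, A.isAnalytification.isHomeomorph.continuous⟩ (2 * n)
          ((1 - t) • y₀ + t • y₁) =
      e A.carrier (2 * n) (deRhamCohomology.mk ⟨(1 - t) • ρ₀ + t • ρ₁, hmem⟩) := by
    rw [map_add, map_smul, map_smul, hy₀, hy₁, hsub, map_add, map_smul, map_smul, map_add,
      map_smul, map_smul]
  have hPt : kroneckerPairing ℝ ℝ (Motives.ComplexPoints X) (2 * n) ((1 - t) • y₀ + t • y₁) z = 0 := by
    rw [map_add, map_smul, map_smul, LinearMap.add_apply, LinearMap.smul_apply,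
      LinearMap.smul_apply, ← ha, ← hb, smul_eq_mul, smul_eq_mul, ht]
    field_simp
    ring
  exact kroneckerPairing_fundamentalClass_ne_zero_of_family hX A e hmem (hne t ⟨ht0, ht1⟩) μ hyt hPt

/-- **For every real de Rham isomorphism family `e` there is an orientation `μ` of `X(ℂ)` for which
the class of a given nowhere-vanishing closed real top form `ρ` of `X^an` (read through `e` and the
analytification `φ`) pairs POSITIVELY with `[X(ℂ)]_μ ⊗ 1`**: the pairing is non-zero for any
orientation (`kroneckerPairing_fundamentalClass_ne_zero_of_family`), and `[X(ℂ)]_{-μ} = -[X(ℂ)]_μ`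
(`fundamentalClass_neg_holds`). For the integration family this is
`exists_orientation_kroneckerPairing_pos`. [cite: MilnorStasheff1974, §13 p. 151]
[cite: HatcherAT2002, §3.3 pp. 234–236] -/
theorem exists_orientation_kroneckerPairing_pos_of_family (hX : Motives.IsSmoothProjective n X)
    (A : HodgeTheory.HodgeModel n X) (e : DeRhamIsoFamily 𝓘(ℝ, A.model))
    {ρ : MForm 𝓘(ℝ, A.model) A.carrier ℝ (2 * n)}
    (hρ : ρ ∈ closedSmoothForms 𝓘(ℝ, A.model) A.carrier ℝ (2 * n)) (hne : ∀ x, ρ x ≠ 0) :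
    ∃ μ : HomologicalOrientation ℤ (Motives.ComplexPoints X) (2 * n),
      ∀ y : singularCohomology ℝ ℝ (Motives.ComplexPoints X) (2 * n),
        singularCohomology.map ℝ ℝ
            ⟨A.toComplexPoints, A.isAnalytification.isHomeomorph.continuous⟩ (2 * n) y =
          e A.carrier (2 * n) (deRhamCohomology.mk ⟨ρ, hρ⟩) →
        0 < kroneckerPairing ℝ ℝ (Motives.ComplexPoints X) (2 * n) y
          (singularHomology.coeffChange (Motives.ComplexPoints X)
            (algebraMap ℤ ℝ : ℤ →+* ℝ).toAddMonoidHom (2 * n) μ.fundamentalClass) := by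
  letI := hX.chartedSpace
  haveI := Motives.ComplexPoints.compactSpace_of_isSmoothProjective hX
  haveI := Motives.ComplexPoints.t2Space_of_isSmoothProjective hX
  haveI := HodgeTheory.connectedSpace_complexPoints hX
  haveI : CompactSpace A.carrier := A.compactSpace_carrier hX
  obtain ⟨μ₀⟩ := Motives.ComplexPoints.isOrientableOver ℤ hX
  -- the class `y₀` with `φ^* y₀ = e[ρ]`
  have hsurj : Function.Surjective (singularCohomology.map ℝ ℝ
      (⟨A.toComplexPoints, A.isAnalytification.isHomeomorph.continuous⟩ : C(A.carrier, _)) (2 * n)) :=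
    (singularCohomology.mapIso ℝ ℝ A.isAnalytification.homeomorph (2 * n)).toLinearEquiv.surjective
  have hinj : Function.Injective (singularCohomology.map ℝ ℝ
      (⟨A.toComplexPoints, A.isAnalytification.isHomeomorph.continuous⟩ : C(A.carrier, _)) (2 * n)) :=
    (singularCohomology.mapIso ℝ ℝ A.isAnalytification.homeomorph (2 * n)).toLinearEquiv.injective
  obtain ⟨y₀, hy₀⟩ := hsurj (e A.carrier (2 * n) (deRhamCohomology.mk ⟨ρ, hρ⟩))
  have h0 := kroneckerPairing_fundamentalClass_ne_zero_of_family hX A e hρ hne μ₀ hy₀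
  have huniq : ∀ y : singularCohomology ℝ ℝ (Motives.ComplexPoints X) (2 * n),
      singularCohomology.map ℝ ℝ
          ⟨A.toComplexPoints, A.isAnalytification.isHomeomorph.continuous⟩ (2 * n) y =
        e A.carrier (2 * n) (deRhamCohomology.mk ⟨ρ, hρ⟩) → y = y₀ :=
    fun y hy ↦ hinj (hy.trans hy₀.symm)
  rcases lt_or_gt_of_ne h0 with h | h
  · refine ⟨-μ₀, fun y hy ↦ ?_⟩
    rw [huniq y hy, HomologicalOrientation.fundamentalClass_neg_holds (R := ℤ)
      (X := Motives.ComplexPoints X) (2 * n) μ₀, map_neg, map_neg]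
    linarith
  · exact ⟨μ₀, fun y hy ↦ by rw [huniq y hy]; exact h⟩


end Orientation

/-! ### Part D: the restricted Fubini–Study class on a prescribed Hodge model -/

section FubiniStudy

open _root_.AlgebraicGeometry _root_.CategoryTheory.Limits
open Literature.AlgebraicGeometry.HodgeTheory Literature.AlgebraicGeometry.Motives
open Literature.AlgebraicGeometry.Motives.AnalytificationKaehler (fubiniStudyPullbackForm)
open Literature.Geometry.Kaehler

variable {n : ℕ} {X : Motives.SchemeOver ℂ}

/-- **The restricted Fubini–Study class is a positive real multiple of a rational class, on a GIVEN
Hodge model** (the tree's `HodgeTheory.exists_fubiniStudy_rational`, Voisin I Thm. 7.10 surrogate,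
whose proof produces the statement for an arbitrary Hodge model `B` of `X` but records it only for
SOME model; the printed proof is repeated verbatim with `B` prescribed): for `X` smooth projective of
dimension `n` and a Hodge model `B` there are a closed immersion `ι : X ⟶ ℙᴺ`, a natural
multiplicative real de Rham family `e` on `B.model`-manifolds, the class `H ∈ H²(X(ℂ); ℂ)` with
`B^* H = e[θ] ⊗ 1` for the restricted Fubini–Study form `θ` of `ι`, and `r > 0` with `r H` rational.
[cite: VoisinHodgeI2002, §7.1.2 and §7.1.3 Thm. 7.10] [cite: SerreGAGA1956, §2 n°5] -/
theorem fubiniStudy_rational_of_hodgeModel (hX : Motives.IsSmoothProjective n X) (B : HodgeModel n X) :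
    ∃ (N : ℕ) (ι : X ⟶ Motives.projectiveSpace N ℂ) (_ : IsClosedImmersion ι.left)
      (e : DeRhamIsoFamily 𝓘(ℝ, B.model)) (_ : e.IsNatural) (_ : e.IsMultiplicative)
      (hθ : fubiniStudyPullbackForm B.model ι B.toComplexPoints ∈ closedSmoothForms 𝓘(ℝ, B.model) B.carrier ℝ 2)
      (H : complexBetti X 2) (r : ℝ),
      B.pullback 2 H = ofRealClass B.carrier 2 (e B.carrier 2
        (deRhamCohomology.mk ⟨fubiniStudyPullbackForm B.model ι B.toComplexPoints, hθ⟩)) ∧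
      0 < r ∧ IsRationalClass ((r : ℂ) • H) := by
  obtain ⟨N, ι, hι⟩ := hX.isProjectiveOver
  haveI := hι
  have hP : Motives.IsSmoothProjective N (Motives.projectiveSpace N ℂ) :=
    Motives.isSmoothProjective_projectiveSpace_holds ℂ N
  obtain ⟨A, -⟩ := exists_isReal_hodgeModel_holds N (Motives.projectiveSpace N ℂ) hP
  obtain ⟨e, he, hem, -⟩ := exists_deRhamIsoFamily_holds B.model
  have hθ := B.fubiniStudyPullbackForm_mem_closedSmoothForms ι
  obtain ⟨H, hH⟩ := B.pullback_surjective 2 (ofRealClass B.carrier 2 (e B.carrier 2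
    (deRhamCohomology.mk ⟨fubiniStudyPullbackForm B.model ι B.toComplexPoints, hθ⟩)))
  refine ⟨N, ι, hι, e, he, hem, hθ, H, ?_⟩
  -- it suffices to show that `H` is a complex multiple of a rational class
  suffices hrat : ∃ (ρ : complexBetti X 2) (μ : ℂ), IsRationalClass ρ ∧ H = μ • ρ by
    obtain ⟨ρ, μ, hρ, rfl⟩ := hrat
    by_cases h0 : μ • ρ = 0
    · refine ⟨1, hH, one_pos, ?_⟩
      rw [h0, smul_zero]
      exact IsRationalClass.zero
    have hK : B.IsKaehlerClassVia e (μ • ρ) :=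
      B.isKaehlerClassVia_of_pullback_eq_fubiniStudyPullbackForm e hX ι hθ hH
    have hconj := hK.conjClass_eq
    rw [conjClass_smul, hρ.conjClass_eq] at hconj
    have hρ0 : ρ ≠ 0 := fun h ↦ h0 (by rw [h, smul_zero])
    have hμ : starRingEnd ℂ μ = μ := smul_left_injective ℂ hρ0 hconj
    have hμre : (μ.re : ℂ) = μ := Complex.conj_eq_iff_re.1 hμ
    have hμ0 : μ.re ≠ 0 := fun h ↦ h0 (by rw [← hμre, h, Complex.ofReal_zero, zero_smul])
    refine ⟨|μ.re|⁻¹, hH, inv_pos.2 (abs_pos.2 hμ0), ?_⟩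
    rw [smul_smul, show ((|μ.re|⁻¹ : ℝ) : ℂ) * μ = ((|μ.re|⁻¹ * μ.re : ℝ) : ℂ) by
      rw [Complex.ofReal_mul, hμre]]
    rcases lt_or_gt_of_ne hμ0 with hneg | hpos
    · rw [abs_of_neg hneg, inv_neg, neg_mul, inv_mul_cancel₀ hμ0, Complex.ofReal_neg,
        Complex.ofReal_one]
      have h := hρ.smul (-1)
      rwa [Rat.cast_neg, Rat.cast_one] at h
    · rw [abs_of_pos hpos, inv_mul_cancel₀ hμ0, Complex.ofReal_one, one_smul]
      exact hρ
  -- the analytified embedding and `θ_X = (ι^an)^* θ_ℙ`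
  have hmn : n ≤ N := dim_le_of_isClosedImmersion_projectiveSpace hX ι B A
  set f := HodgeModel.anMap A B ι with hfdef
  have hfan : ContMDiff 𝓘(ℝ, B.model) 𝓘(ℝ, A.model) ∞ f := HodgeModel.contMDiff_anMap A B ι hX hP
  have hfd : MDifferentiable 𝓘(ℝ, B.model) 𝓘(ℝ, A.model) f :=
    (HodgeModel.mdifferentiable_anMap A B ι hX hP).real_of_complex
  have hθX := fubiniStudyPullbackForm_eq_pullback ι (E := B.model) (φ := B.toComplexPoints)
    A.isAnalytification (f := f) (HodgeModel.toComplexPoints_anMap A B ι) hfd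
  have hθP := A.fubiniStudyPullbackForm_mem_closedSmoothForms (𝟙 (Motives.projectiveSpace N ℂ))
  -- the de Rham classes of `θ_ℙ ⊗ 1` and `θ_X ⊗ 1`
  set wP : complexDeRhamCohomology A.model A.carrier 2 :=
    complexDeRhamCohomology.ofReal A.model A.carrier 2
      (deRhamCohomology.mk ⟨fubiniStudyPullbackForm A.model (𝟙 (Motives.projectiveSpace N ℂ)) A.toComplexPoints, hθP⟩) with hwP
  set wX : complexDeRhamCohomology B.model B.carrier 2 :=
    complexDeRhamCohomology.ofReal B.model B.carrier 2
      (deRhamCohomology.mk ⟨fubiniStudyPullbackForm B.model ι B.toComplexPoints, hθ⟩) with hwX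
  have hwPX : complexDeRhamCohomology.map B.model hfan 2 wP = wX := by
    rw [hwP, hwX, complexDeRhamCohomology.ofReal_mk, complexDeRhamCohomology.ofReal_mk,
      complexDeRhamCohomology.map_mk]
    congr 1
    apply Subtype.ext
    change (fubiniStudyPullbackForm A.model (𝟙 (Motives.projectiveSpace N ℂ)) A.toComplexPoints).ofReal.pullback 𝓘(ℝ, B.model) f =
      (fubiniStudyPullbackForm B.model ι B.toComplexPoints).ofReal
    rw [hθX, mform_ofReal_pullback]
  -- a class `c_ℙ` on `ℙᴺ(ℂ)` comparing to `θ_ℙ ⊗ 1` in the model `A`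
  obtain ⟨cP, hcP⟩ := A.pullback_surjective 2 (A.deRham A.carrier 2 wP)
  -- compatibility compactness instances on `X^an`
  haveI : CompactSpace B.carrier := by
    haveI := Motives.ComplexPoints.compactSpace_of_isSmoothProjective hX
    exact B.isAnalytification.homeomorph.symm.compactSpace
  -- (d) the induced comparison: `B^*(ι^* c_ℙ) = e''[θ_X ⊗ 1]`
  have hd : HodgeModel.inducedIso A B hmn B.carrier 2 wX =
      B.pullback 2 (singularCohomology.map ℂ ℂ (Motives.AlgPoints.mapContinuous (L := ℂ) ι) 2 cP) := by
    rw [← hwPX, HodgeModel.inducedIso_apply,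
      ← LinearMap.comp_apply (g := complexDeRhamCohomology.map B.model hfan 2),
      ← complexDeRhamCohomology.map_comp hfan (contMDiff_cylFst A B hmn B.carrier),
      A.deRham_isNatural (Cyl A B hmn B.carrier) A.carrier _
        (hfan.comp (contMDiff_cylFst A B hmn B.carrier)) 2 wP,
      ← hcP, ← HodgeModel.map_anMap_pullback]
    change ((singularCohomology.map ℂ ℂ _ 2 ≫ singularCohomology.map ℂ ℂ _ 2).hom _) = _
    rw [← singularCohomology.map_comp]
    rfl
  -- (e) rigidity: `e ⊗ ℂ = r • e''` on `H²_dR(X^an; ℂ)`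
  obtain ⟨r, hr⟩ := NaturalDeRhamComparisonRigidity_holds B.model B.model
    (HodgeModel.inducedFamily A B hmn) (HodgeModel.isNatural_inducedFamily A B hmn)
    e.complexify (DeRhamIsoFamily.complexify_isNatural he) B.carrier B.carrier (Homeomorph.refl _)
    contMDiff_id contMDiff_id 2
  have hrX : e.complexify B.carrier 2 wX = r • HodgeModel.inducedIso A B hmn B.carrier 2 wX := by
    have h := hr wX
    have hid : (⟨Homeomorph.refl B.carrier, (Homeomorph.refl B.carrier).continuous⟩ :
        C(B.carrier, B.carrier)) = ContinuousMap.id B.carrier := rfl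
    rw [hid, singularCohomology.map_id] at h
    change e.complexify B.carrier 2 wX =
      r • HodgeModel.inducedIso A B hmn B.carrier 2 (complexDeRhamCohomology.map B.model contMDiff_id 2 wX) at h
    rwa [complexDeRhamCohomology.map_id, LinearMap.id_apply] at h
  -- hence `H = r • ι^* c_ℙ`
  have hH' : H = r • singularCohomology.map ℂ ℂ (Motives.AlgPoints.mapContinuous (L := ℂ) ι) 2 cP := by
    apply B.pullback_injective 2
    rw [hH, _root_.map_smul, ← hd, ← hrX, complexify_apply, hwX, complexifyFun_ofReal]
  -- (f) `H²(ℙᴺ(ℂ); ℂ)` is spanned by one rational class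
  rcases Nat.eq_zero_or_pos N with hN | hN
  · subst hN
    haveI := Motives.ComplexPoints.subsingleton_singularCohomology_of_lt hP ℂ (k := 2) (by omega)
    refine ⟨0, 0, IsRationalClass.zero, ?_⟩
    rw [hH', Subsingleton.elim cP 0, map_zero, smul_zero, smul_zero]
  have h1 : Module.finrank ℂ (complexBetti (Motives.projectiveSpace N ℂ) 2) = 1 :=
    finrank_complexBetti_projectiveSpace_two_mul_eq_one N (p := 1) hN
  obtain ⟨rP, hrP, -, hspan⟩ := exists_mem_ne_zero_of_span_eq_top
    (span_isRationalClass_eq_top_of_isSmoothProjective_holds N (Motives.projectiveSpace N ℂ) hP 2) h1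
  obtain ⟨lam, hlam⟩ := hspan cP
  refine ⟨singularCohomology.map ℂ ℂ (Motives.AlgPoints.mapContinuous (L := ℂ) ι) 2 rP, r * lam,
    IsRationalClass.map _ hrP, ?_⟩
  rw [hH', ← hlam, _root_.map_smul, smul_smul]


end FubiniStudy

/-! ### Part E: Hodge–Riemann positivity on `H^{2,0}` and Kähler positivity, for the complex orientation of a K3 surface -/

section K3

open Literature.AlgebraicGeometry.HodgeTheory (complexifyFun ofRealClass conjClass)

variable {S : Motives.SchemeOver ℂ}

/-- **Clause (ii) — the Hodge–Riemann positivity `(σ̄.σ) > 0` on `H^{2,0}` — together with the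
Kähler positivity `∫ ω ∧ ω > 0`, for ONE orientation of `S(ℂ)` (the complex one), on a given Hodge
model `A` of the K3 surface `S` carrying a nowhere-vanishing holomorphic `2`-form `η`, read through an
ARBITRARY natural multiplicative real de Rham isomorphism family `e`.** There is a `ℤ`-orientation
`μ` of `S(ℂ)` such that (a) for every non-zero `(2,0)`-class `σ ∈ H²(S(ℂ); ℂ)` and every
`g ∈ H⁴(S(ℂ); ℤ)` with `⟨g, [S(ℂ)]_μ⟩ = 1`: `σ̄ ∪ σ = c • (g ⊗ 1)` with `re c > 0` (Huybrechts,
*Lectures on K3 Surfaces*, Ch. 6 Prop. 1.2 (ii): "(σ.σ̄) > 0"; Ch. 3 §1.1; Voisin I §6.3.2: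
`∫_X σ ∧ σ̄ > 0` for a non-zero holomorphic `2`-form on a surface), and (b) for every smooth Kähler
metric on `A.carrier` with Kähler form `ω`, the class `y ∈ H⁴(S(ℂ); ℝ)` with `φ^* y = e[ω ∧ ω]`
has `⟨y, [S(ℂ)]_μ ⊗ 1⟩ > 0` (Voisin I §3.1.3 Lemma 3.8: `ω²/2` is the volume form of the complex
orientation). Proof, following the printed one on the tree's carriers: `μ` is the orientation for
which `e[Re(η ∧ η̄)]` pairs positively with `[S(ℂ)]` (`Re(η ∧ η̄)` is a NOWHERE-VANISHING real top
form, `re_wedge_conj_apply_ne_zero`; `exists_orientation_kroneckerPairing_pos_of_family`). For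
(a): `σ = t [η]` (`h^{2,0} = 1`, `Huybrechts_K3_hodgeTypes_H2_holds`; `[η] ≠ 0` by Voisin I Cor. 7.6,
`Voisin2002_closedForm_top_zero_not_exact_holds`), read in the Hodge model whose comparison is
`e ⊗ ℂ` (model independence, `hodgePQ_independent_of_hodgeModel_holds`); there `[η̄] = \overline{[η]}`
(`conjClass_complexifyFun`) and `[η] ∪ [η̄] = (e ⊗ ℂ)[η ∧ η̄]` (multiplicativity,
`complexifyFun_mk_wedge`), whose real part is `e[Re(η ∧ η̄)]`; `H⁴(S(ℂ); ℝ) = ℝ (g ⊗ 1)`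
(`eq_smul_ringChange_of_kroneckerPairing_eq_one`) turns this into `σ ∪ σ̄ = (r₁ + i r₂)(g ⊗ 1)`,
`r₁ > 0`, and `σ̄ ∪ σ = σ ∪ σ̄` in even degree (`cupProduct_gradedComm_holds`). For (b): `Re(η ∧ η̄)`
and `ω ∧ ω` are both positive on complex frames, so all their convex combinations vanish nowhere
(`convex_re_wedge_conj_wedge_self_apply_ne_zero`) and the sign of the pairing cannot change along the
segment (`kroneckerPairing_fundamentalClass_pos_of_convex_of_family`).
[cite: Huybrechts2016K3, Ch. 6 Prop. 1.2 (ii) and Ch. 3 §1.1] [cite: VoisinHodgeI2002, §6.3.2, Cor. 7.6 and §3.1.3 Lemma 3.8]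
[cite: MilnorStasheff1974, §13 p. 151] -/
theorem IsK3Surface.exists_orientation_hodgeRiemann_kaehler (hS : IsK3Surface S)
    (A : HodgeTheory.HodgeModel 2 S) {η : MForm 𝓘(ℝ, A.model) A.carrier ℂ 2}
    (hη : Literature.Geometry.Kaehler.IsHolomorphicInCharts η) (hη0 : ∀ x, η x ≠ 0)
    (e : DeRhamIsoFamily 𝓘(ℝ, A.model)) (he : e.IsNatural) (hem : e.IsMultiplicative) :
    ∃ μ : HomologicalOrientation ℤ (Motives.ComplexPoints S) (2 * 2),
      (∀ σ : HodgeTheory.complexBetti S (2 * 1), HodgeTheory.IsOfHodgeType 2 S (2 * 1) 2 0 σ →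
        σ ≠ 0 → ∀ g : singularCohomology ℤ ℤ (Motives.ComplexPoints S) (2 * 2),
          kroneckerPairing ℤ ℤ (Motives.ComplexPoints S) (2 * 2) g μ.fundamentalClass = 1 →
            ∃ c : ℂ, 0 < c.re ∧
              cupProduct (rfl : 2 * 1 + 2 * 1 = 2 * 2)
                (HodgeTheory.conjClass (Motives.ComplexPoints S) (2 * 1) σ) σ =
                  c • singularCohomology.ringChange (algebraMap ℤ ℂ) (Motives.ComplexPoints S)
                    (2 * 2) g) ∧
      ∀ (gK : Bundle.ContMDiffRiemannianMetric 𝓘(ℝ, A.model) ∞ A.model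
          (fun x : A.carrier ↦ TangentSpace 𝓘(ℝ, A.model) x))
        (_ : gK.toRiemannianMetric.IsKaehler)
        (hω : gK.toRiemannianMetric.kaehlerForm.wedge gK.toRiemannianMetric.kaehlerForm ∈
          closedSmoothForms 𝓘(ℝ, A.model) A.carrier ℝ (2 + 2))
        (y : singularCohomology ℝ ℝ (Motives.ComplexPoints S) (2 * 2)),
        singularCohomology.map ℝ ℝ
            ⟨A.toComplexPoints, A.isAnalytification.isHomeomorph.continuous⟩ (2 * 2) y =
          e A.carrier (2 * 2) (deRhamCohomology.mk
            ⟨gK.toRiemannianMetric.kaehlerForm.wedge gK.toRiemannianMetric.kaehlerForm, hω⟩) →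
        0 < kroneckerPairing ℝ ℝ (Motives.ComplexPoints S) (2 * 2) y
          (singularHomology.coeffChange (Motives.ComplexPoints S)
            (algebraMap ℤ ℝ : ℤ →+* ℝ).toAddMonoidHom (2 * 2) μ.fundamentalClass) := by
  classical
  have hX := hS.isSmoothProjective
  letI := hX.chartedSpace
  haveI := Motives.ComplexPoints.compactSpace_of_isSmoothProjective hX
  haveI := Motives.ComplexPoints.t2Space_of_isSmoothProjective hX
  haveI := HodgeTheory.connectedSpace_complexPoints hX
  haveI : CompactSpace A.carrier := A.compactSpace_carrier hX
  haveI : Nonempty A.carrier := ⟨A.isAnalytification.homeomorph.symm (Classical.arbitrary _)⟩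
  have hfin : Module.finrank ℂ A.model = 2 := A.isAnalytification.finrank_eq
  -- `A.carrier` is compact Kähler (binder of Voisin I Cor. 7.6)
  haveI : AlgebraicGeometry.SmoothOfRelativeDimension 2 S.hom := hX.smoothOfRelativeDimension
  obtain ⟨N, ι, hι⟩ := hX.isProjectiveOver
  haveI : Literature.Geometry.Kaehler.IsKaehlerManifold A.model A.carrier :=
    Motives.isKaehlerManifold_of_isAnalytification_of_isClosedImmersion_holds (X := S) (d := 2)
      (E := A.model) (M := A.carrier) (φ := A.toComplexPoints) ι A.isAnalytification
  -- wedge calculus on `A.carrier`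
  haveI : WedgeFacts 𝓘(ℝ, A.model) A.carrier ℝ :=
    wedgeFacts_of_assoc 𝓘(ℝ, A.model) A.carrier ℝ (ContinuousAlternatingMap.WedgeAssoc_holds ℝ A.model ℝ)
  haveI : WedgeFacts 𝓘(ℝ, A.model) A.carrier ℂ :=
    wedgeFacts_of_assoc 𝓘(ℝ, A.model) A.carrier ℂ (ContinuousAlternatingMap.WedgeAssoc_holds ℝ A.model ℂ)
  -- the K3 form `η`: smooth, closed, of type `(2,0)`, nowhere zero, not exact
  have hηs : IsSmoothForm η := hη.isSmoothForm
  have hηc : IsClosedForm η := hη.isClosedForm hfin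
  have hηt : IsOfType 2 0 η := hη.isOfType
  have hcc : η ∈ cclosedSmoothForms A.model A.carrier 2 := hη.mem_cclosedSmoothForms hfin
  have hcc' : η.conj ∈ cclosedSmoothForms A.model A.carrier 2 := conj_mem_cclosedSmoothForms_holds hcc
  have hne0 : η ≠ 0 := fun h ↦ by
    obtain ⟨x⟩ := (inferInstance : Nonempty A.carrier)
    exact hη0 x (by rw [h]; rfl)
  have hnex : η ∉ cexactSmoothForms A.model A.carrier 2 :=
    HodgeTheory.Voisin2002_closedForm_top_zero_not_exact_holds A.model A.carrier 2 hfin η hηs hηc hηt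
      hne0
  -- `ζ = η ∧ η̄`, its real part `ρ` vanishes nowhere
  have hζ : η.wedge η.conj ∈ cclosedSmoothForms A.model A.carrier (2 + 2) :=
    HodgeTheory.wedge_mem_cclosedSmoothForms hcc hcc'
  have hρ : (η.wedge η.conj).re ∈ closedSmoothForms 𝓘(ℝ, A.model) A.carrier ℝ (2 + 2) :=
    re_mem_closedSmoothForms hζ
  have hρne : ∀ x, (η.wedge η.conj).re x ≠ 0 := fun x ↦
    re_wedge_conj_apply_ne_zero hfin hηt (hη0 x)
  -- the complex orientation of `S(ℂ)`, read through `e`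
  obtain ⟨μ, hμ⟩ := exists_orientation_kroneckerPairing_pos_of_family (n := 2) hX A e hρ hρne
  refine ⟨μ, fun σ hσ hσ0 g hg ↦ ?_, fun gK hgK hω y hy ↦ ?_⟩
  · -- (a) the Hodge–Riemann positivity on `H^{2,0}`
    -- the Hodge model `A'` whose comparison is `e ⊗ ℂ`
    let A' : HodgeTheory.HodgeModel 2 S :=
      { A with
        deRham := e.complexify
        deRham_isNatural := DeRhamIsoFamily.complexify_isNatural he }
    -- the class `u = [η] ∈ H^{2,0}(A)`, non-zero, and its transport `σ₀` to `H²(S(ℂ); ℂ)`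
    set u := complexDeRhamCohomology.mk A.model A.carrier 2 ⟨η, hcc⟩ with hu_def
    have hu20 : u ∈ hodgePQ A.model A.carrier 2 2 0 := Submodule.subset_span ⟨⟨η, hcc⟩, hηt, rfl⟩
    have hu0 : u ≠ 0 := by
      intro h0
      rw [hu_def, ← (complexDeRhamCohomology.mk A.model A.carrier 2).map_zero,
        complexDeRhamCohomology.mk_eq_mk_iff] at h0
      exact hnex (by simpa using h0)
    obtain ⟨σ₀, hσ₀⟩ := A'.pullback_surjective (2 * 1) (complexifyFun e 2 u)
    have hσ₀' : singularCohomology.map ℂ ℂ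
        (⟨A.toComplexPoints, A.isAnalytification.isHomeomorph.continuous⟩ : C(A.carrier, _)) (2 * 1) σ₀ =
          complexifyFun e 2 u := hσ₀
    have hσ₀T : HodgeTheory.IsOfHodgeType 2 S (2 * 1) 2 0 σ₀ := ⟨A', by
      show A'.pullback 2 σ₀ ∈ A'.hodgePQ 2 2 0
      rw [show A'.pullback 2 σ₀ = complexifyFun e 2 u from hσ₀]
      exact Submodule.mem_map_of_mem hu20⟩
    have hσ₀0 : σ₀ ≠ 0 := by
      intro h0
      apply hu0
      have h1 : complexifyFun e 2 u = 0 := by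
        rw [← hσ₀', h0, map_zero]
      apply (e.complexifyEquiv A.carrier 2).injective
      rw [HodgeTheory.complexifyEquiv_apply, h1, map_zero]
    -- `σ = t • σ₀`, `t ≠ 0` (`h^{2,0} = 1`)
    obtain ⟨t, rfl⟩ := ((Huybrechts_K3_hodgeTypes_H2_holds S hS σ₀ hσ₀T hσ₀0).1 σ).1 hσ
    have ht : t ≠ 0 := by
      rintro rfl
      exact hσ0 (zero_smul _ _)
    -- the real classes `y₁, y₂` on `S(ℂ)` with `φ^* y₁ = e[Re ζ]`, `φ^* y₂ = e[Im ζ]`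
    have hsurjℝ : Function.Surjective (singularCohomology.map ℝ ℝ
        (⟨A.toComplexPoints, A.isAnalytification.isHomeomorph.continuous⟩ : C(A.carrier, _)) (2 * 2)) :=
      (singularCohomology.mapIso ℝ ℝ A.isAnalytification.homeomorph (2 * 2)).toLinearEquiv.surjective
    obtain ⟨y₁, hy₁⟩ := hsurjℝ (e A.carrier (2 * 2) (deRhamCohomology.mk ⟨(η.wedge η.conj).re, hρ⟩))
    obtain ⟨y₂, hy₂⟩ := hsurjℝ (e A.carrier (2 * 2)
      (deRhamCohomology.mk ⟨(η.wedge η.conj).im, im_mem_closedSmoothForms hζ⟩))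
    -- `r₁ = ⟨y₁, [S(ℂ)]_μ ⊗ 1⟩ > 0`, and `yᵢ = rᵢ • (g ⊗ 1)`
    have hr₁ := hμ y₁ hy₁
    set r₁ := kroneckerPairing ℝ ℝ (Motives.ComplexPoints S) (2 * 2) y₁
      (singularHomology.coeffChange (Motives.ComplexPoints S) (algebraMap ℤ ℝ : ℤ →+* ℝ).toAddMonoidHom
        (2 * 2) μ.fundamentalClass) with hr₁_def
    set r₂ := kroneckerPairing ℝ ℝ (Motives.ComplexPoints S) (2 * 2) y₂
      (singularHomology.coeffChange (Motives.ComplexPoints S) (algebraMap ℤ ℝ : ℤ →+* ℝ).toAddMonoidHom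
        (2 * 2) μ.fundamentalClass) with hr₂_def
    have hy₁' := eq_smul_ringChange_of_kroneckerPairing_eq_one μ hg y₁
    have hy₂' := eq_smul_ringChange_of_kroneckerPairing_eq_one μ hg y₂
    rw [← hr₁_def] at hy₁'
    rw [← hr₂_def] at hy₂'
    -- KEY: `σ₀ ∪ σ̄₀ = (r₁ + i r₂) • (g ⊗ 1)` — checked after pull-back to the model
    have key : cupProduct (rfl : 2 * 1 + 2 * 1 = 2 * 2) σ₀
        (HodgeTheory.conjClass (Motives.ComplexPoints S) (2 * 1) σ₀) =
          ((r₁ : ℂ) + (r₂ : ℂ) * Complex.I) •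
            singularCohomology.ringChange (algebraMap ℤ ℂ) (Motives.ComplexPoints S) (2 * 2) g := by
      apply A'.pullback_injective (2 * 2)
      change singularCohomology.map ℂ ℂ
          (⟨A.toComplexPoints, A.isAnalytification.isHomeomorph.continuous⟩ : C(A.carrier, _)) (2 * 2) _ =
        singularCohomology.map ℂ ℂ
          (⟨A.toComplexPoints, A.isAnalytification.isHomeomorph.continuous⟩ : C(A.carrier, _)) (2 * 2) _
      -- left: `φ^*(σ₀ ∪ σ̄₀) = (e ⊗ ℂ)[η ∧ η̄]`
      have hL : singularCohomology.map ℂ ℂ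
          (⟨A.toComplexPoints, A.isAnalytification.isHomeomorph.continuous⟩ : C(A.carrier, _)) (2 * 2)
            (cupProduct (rfl : 2 * 1 + 2 * 1 = 2 * 2) σ₀
              (HodgeTheory.conjClass (Motives.ComplexPoints S) (2 * 1) σ₀)) =
          complexifyFun e (2 + 2)
            (complexDeRhamCohomology.mk A.model A.carrier (2 + 2) ⟨η.wedge η.conj, hζ⟩) := by
        rw [cupProduct_map, ← HodgeTheory.conjClass_map, hσ₀']
        show cupProduct (rfl : 2 + 2 = 2 + 2) (complexifyFun e 2 u)
            (conjClass A.carrier 2 (complexifyFun e 2 u)) = _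
        rw [HodgeTheory.conjClass_complexifyFun, hu_def, complexDeRhamCohomology.conj_mk]
        exact (HodgeTheory.complexifyFun_mk_wedge hem ⟨η, hcc⟩ ⟨η.conj, _⟩).symm
      -- right: `φ^*((r₁ + i r₂) • (g ⊗ 1)) = e[Re ζ] ⊗ 1 + i • e[Im ζ] ⊗ 1 = (e ⊗ ℂ)[ζ]`
      have hR : singularCohomology.map ℂ ℂ
          (⟨A.toComplexPoints, A.isAnalytification.isHomeomorph.continuous⟩ : C(A.carrier, _)) (2 * 2)
            (((r₁ : ℂ) + (r₂ : ℂ) * Complex.I) •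
              singularCohomology.ringChange (algebraMap ℤ ℂ) (Motives.ComplexPoints S) (2 * 2) g) =
          complexifyFun e (2 + 2)
            (complexDeRhamCohomology.mk A.model A.carrier (2 + 2) ⟨η.wedge η.conj, hζ⟩) := by
        have hsum : ((r₁ : ℂ) + (r₂ : ℂ) * Complex.I) •
            singularCohomology.ringChange (algebraMap ℤ ℂ) (Motives.ComplexPoints S) (2 * 2) g =
              ofRealClass (Motives.ComplexPoints S) (2 * 2) y₁ +
                Complex.I • ofRealClass (Motives.ComplexPoints S) (2 * 2) y₂ := by
          conv_rhs => rw [hy₁', hy₂']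
          rw [HodgeTheory.ofRealClass_smul, HodgeTheory.ofRealClass_smul, ofRealClass_ringChange_int,
            smul_smul, add_smul, mul_comm Complex.I]
        rw [hsum, map_add, map_smul, ← HodgeTheory.ofRealClass_map, ← HodgeTheory.ofRealClass_map, hy₁,
          hy₂, complexifyFun, complexDeRhamCohomology.re_mk, complexDeRhamCohomology.im_mk]
      rw [hL, hR]
    -- `σ̄₀ ∪ σ₀ = σ₀ ∪ σ̄₀` (even degrees)
    have hcomm : cupProduct (rfl : 2 * 1 + 2 * 1 = 2 * 2)
        (HodgeTheory.conjClass (Motives.ComplexPoints S) (2 * 1) σ₀) σ₀ =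
          cupProduct (rfl : 2 * 1 + 2 * 1 = 2 * 2) σ₀
            (HodgeTheory.conjClass (Motives.ComplexPoints S) (2 * 1) σ₀) := by
      rw [cupProduct_gradedComm_holds ℂ (Motives.ComplexPoints S) rfl rfl _ σ₀]
      have h4 : ((-1 : ℂ) ^ (2 * 1 * (2 * 1))) = 1 := by norm_num
      rw [h4, one_smul]
    -- assemble for `σ = t • σ₀`
    refine ⟨starRingEnd ℂ t * t * ((r₁ : ℂ) + (r₂ : ℂ) * Complex.I), ?_, ?_⟩
    · rw [← Complex.normSq_eq_conj_mul_self]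
      simp only [Complex.mul_re, Complex.add_re, Complex.ofReal_re, Complex.mul_im, Complex.add_im,
        Complex.ofReal_im, Complex.I_re, Complex.I_im, mul_zero, mul_one, zero_add, add_zero, sub_zero,
        zero_mul]
      exact mul_pos (Complex.normSq_pos.2 ht) hr₁
    · rw [HodgeTheory.conjClass_smul, map_smul, map_smul, LinearMap.smul_apply, hcomm, key, smul_smul,
        smul_smul]
      congr 1
      ring
  · -- (b) the Kähler positivity `⟨e[ω ∧ ω], [S(ℂ)]_μ ⊗ 1⟩ > 0` by deformation from `Re(η ∧ η̄)`
    have hsurjℝ : Function.Surjective (singularCohomology.map ℝ ℝ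
        (⟨A.toComplexPoints, A.isAnalytification.isHomeomorph.continuous⟩ : C(A.carrier, _)) (2 * 2)) :=
      (singularCohomology.mapIso ℝ ℝ A.isAnalytification.homeomorph (2 * 2)).toLinearEquiv.surjective
    obtain ⟨y₁, hy₁⟩ := hsurjℝ (e A.carrier (2 * 2) (deRhamCohomology.mk ⟨(η.wedge η.conj).re, hρ⟩))
    have hherm := hgK.isHermitian
    refine kroneckerPairing_fundamentalClass_pos_of_convex_of_family (n := 2) hX A e hρ hω
      (fun t ht x ↦ ?_) μ hy₁ hy (hμ y₁ hy₁)
    exact convex_re_wedge_conj_wedge_self_apply_ne_zero hfin hηt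
      (fun x v hv ↦ HodgeTheory.kaehlerForm_self_tangentJ_pos gK.toRiemannianMetric hherm x v hv)
      (fun x v w ↦ hherm.kaehlerForm_tangentJ_tangentJ x v w) (hη0 x) ht

/-- **Clause (ii) of `K3_exists_orientation_signature_hodgeRiemann_ample`, for every K3 surface**:
there is a `ℤ`-orientation `μ` of `S(ℂ)` such that for every non-zero `(2,0)`-class
`σ ∈ H²(S(ℂ); ℂ)` and every `g ∈ H⁴(S(ℂ); ℤ)` with `⟨g, [S(ℂ)]_μ⟩ = 1`: `σ̄ ∪ σ = c • (g ⊗ 1)` with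
`re c > 0` (Huybrechts Ch. 6 Prop. 1.2 (ii); Voisin I §6.3.2): the first conjunct of
`IsK3Surface.exists_orientation_hodgeRiemann_kaehler` on the Hodge model of the K3 form, read through
the integration isomorphism of de Rham's theorem (natural and multiplicative,
`integrationDeRhamIsoFamily_isNatural`, `integrationDeRhamIsoFamily_isMultiplicative`).
[cite: Huybrechts2016K3, Ch. 6 Prop. 1.2 (ii) and Ch. 3 §1.1] [cite: VoisinHodgeI2002, §6.3.2 and Cor. 7.6] -/
theorem IsK3Surface.exists_orientation_hodgeRiemann_twoZero (hS : IsK3Surface S) :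
    ∃ μ : HomologicalOrientation ℤ (Motives.ComplexPoints S) (2 * 2),
      ∀ σ : HodgeTheory.complexBetti S (2 * 1), HodgeTheory.IsOfHodgeType 2 S (2 * 1) 2 0 σ →
        σ ≠ 0 → ∀ g : singularCohomology ℤ ℤ (Motives.ComplexPoints S) (2 * 2),
          kroneckerPairing ℤ ℤ (Motives.ComplexPoints S) (2 * 2) g μ.fundamentalClass = 1 →
            ∃ c : ℂ, 0 < c.re ∧
              cupProduct (rfl : 2 * 1 + 2 * 1 = 2 * 2)
                (HodgeTheory.conjClass (Motives.ComplexPoints S) (2 * 1) σ) σ =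
                  c • singularCohomology.ringChange (algebraMap ℤ ℂ) (Motives.ComplexPoints S)
                    (2 * 2) g := by
  obtain ⟨A, η, hη, hη0⟩ := hS.exists_holomorphicTwoForm_ne_zero
  obtain ⟨μ, hμ, -⟩ := hS.exists_orientation_hodgeRiemann_kaehler A hη hη0
    (integrationDeRhamIsoFamily A.model) integrationDeRhamIsoFamily_isNatural
    integrationDeRhamIsoFamily_isMultiplicative
  exact ⟨μ, hμ⟩

/-- **The orientation of clause (ii) is unique** — so "the complex orientation of `S(ℂ)`" is
pinned homologically by the Hodge–Riemann positivity on `H^{2,0}`: two `ℤ`-orientations of `S(ℂ)`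
for which `σ̄ ∪ σ` is a multiple with positive real part of the Kronecker dual of the fundamental
class cannot be opposite (the connected closed `4`-manifold `S(ℂ)` has exactly the two orientations
`±ν`, Hatcher §3.3 p. 234, `eq_or_eq_neg_of_connected_holds`; `[S(ℂ)]_{-ν} = -[S(ℂ)]_ν`,
`fundamentalClass_neg_holds`; and a non-zero `(2,0)`-class exists, Voisin I Cor. 7.6). This is the
homological form of "every complex manifold has a preferred orientation" (Milnor–Stasheff §13
p. 151) for K3 surfaces. [cite: MilnorStasheff1974, §13 p. 151] [cite: HatcherAT2002, §3.3 p. 234 and p. 236]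
[cite: Huybrechts2016K3, Ch. 6 Prop. 1.2 (ii)] -/
theorem IsK3Surface.orientation_unique_of_hodgeRiemann_twoZero (hS : IsK3Surface S)
    {μ ν : HomologicalOrientation ℤ (Motives.ComplexPoints S) (2 * 2)}
    (hμ : ∀ σ : HodgeTheory.complexBetti S (2 * 1), HodgeTheory.IsOfHodgeType 2 S (2 * 1) 2 0 σ →
        σ ≠ 0 → ∀ g : singularCohomology ℤ ℤ (Motives.ComplexPoints S) (2 * 2),
          kroneckerPairing ℤ ℤ (Motives.ComplexPoints S) (2 * 2) g μ.fundamentalClass = 1 →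
            ∃ c : ℂ, 0 < c.re ∧
              cupProduct (rfl : 2 * 1 + 2 * 1 = 2 * 2)
                (HodgeTheory.conjClass (Motives.ComplexPoints S) (2 * 1) σ) σ =
                  c • singularCohomology.ringChange (algebraMap ℤ ℂ) (Motives.ComplexPoints S)
                    (2 * 2) g)
    (hν : ∀ σ : HodgeTheory.complexBetti S (2 * 1), HodgeTheory.IsOfHodgeType 2 S (2 * 1) 2 0 σ →
        σ ≠ 0 → ∀ g : singularCohomology ℤ ℤ (Motives.ComplexPoints S) (2 * 2),
          kroneckerPairing ℤ ℤ (Motives.ComplexPoints S) (2 * 2) g ν.fundamentalClass = 1 →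
            ∃ c : ℂ, 0 < c.re ∧
              cupProduct (rfl : 2 * 1 + 2 * 1 = 2 * 2)
                (HodgeTheory.conjClass (Motives.ComplexPoints S) (2 * 1) σ) σ =
                  c • singularCohomology.ringChange (algebraMap ℤ ℂ) (Motives.ComplexPoints S)
                    (2 * 2) g) :
    μ = ν := by
  have hX := hS.isSmoothProjective
  letI := hX.chartedSpace
  haveI := Motives.ComplexPoints.compactSpace_of_isSmoothProjective hX
  haveI := Motives.ComplexPoints.t2Space_of_isSmoothProjective hX
  haveI := HodgeTheory.connectedSpace_complexPoints hX
  rcases HomologicalOrientation.eq_or_eq_neg_of_connected_holds (Motives.ComplexPoints S) μ ν with h | h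
  · exact h
  · exfalso
    obtain ⟨σ, hσ0, hσ⟩ := hS.exists_isOfHodgeType_twoZero_ne_zero
      (fun E _ _ _ M _ _ ↦ HodgeTheory.Voisin2002_closedForm_top_zero_not_exact_holds E M)
    obtain ⟨g, hg1, -, hgne, -⟩ := exists_integral_orientation_generator_top hX ν
    have hg1' : kroneckerPairing ℤ ℤ (Motives.ComplexPoints S) (2 * 2) (-g) μ.fundamentalClass = 1 := by
      rw [h, HomologicalOrientation.fundamentalClass_neg_holds (R := ℤ) (X := Motives.ComplexPoints S)
        (2 * 2) ν, map_neg, map_neg, LinearMap.neg_apply, neg_neg, hg1]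
    obtain ⟨c, hc, hcσ⟩ := hν σ hσ hσ0 g hg1
    obtain ⟨c', hc', hc'σ⟩ := hμ σ hσ hσ0 (-g) hg1'
    rw [hcσ, map_neg, smul_neg, ← neg_smul] at hc'σ
    have hcc' : c = -c' := smul_left_injective ℂ hgne hc'σ
    have : c.re = -c'.re := by rw [hcc', Complex.neg_re]
    linarith

/-! ### Part F: clauses (ii) and (iii) for the complex orientation; the fact reduced to the index -/

/-- **Clauses (ii) AND (iii) of `K3_exists_orientation_signature_hodgeRiemann_ample` hold for one
orientation of `S(ℂ)` (the complex one).** For every K3 surface `S` there is a `ℤ`-orientation `μ`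
of `S(ℂ)` with the Hodge–Riemann positivity (ii) on `H^{2,0}` and (iii) an integral class
`u ∈ H²(S(ℂ); ℤ)` with `u ⊗ 1` of type `(1,1)` and `⟨u ∪ u, [S(ℂ)]_μ⟩ > 0`. Printed proof of (iii)
(Huybrechts, *Lectures on K3 Surfaces*, Ch. 1 §2.2 and Prop. 3.2: `S` is projective, the first Chern
class of an ample line bundle `L` is an integral `(1,1)`-class with `(L.L) > 0`; Voisin I Thm. 7.10:
`[ω_FS|_S] = c₁(𝒪_S(1))`), followed on the tree's carriers: on the Hodge model `A` of the K3 form `η`,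
the restricted Fubini–Study class `H` of a projective embedding is a Kähler class
(`isKaehlerClassVia_of_pullback_eq_fubiniStudyPullbackForm`), hence of type `(1,1)`
(`IsKaehlerClassVia.isOfHodgeType_one_one`), and a positive real multiple `r H` is RATIONAL
(`fubiniStudy_rational_of_hodgeModel`, the tree's surrogate of Voisin I Thm. 7.10), so an integral
class `u` has `u ⊗ 1 = N r H`, `N ≥ 1` (`exists_nsmul_isIntegralClass_of_isRationalClass_holds`,
Voisin I §7.1.1); and `⟨u ∪ u, [S(ℂ)]_μ⟩ = (N r)² ⟨e[ω ∧ ω], [S(ℂ)]_μ ⊗ 1⟩ > 0` for the Kähler form `ω`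
representing `H` (multiplicativity of `e`, `⊗ 1` and `φ^*`; the Kähler positivity conjunct of
`IsK3Surface.exists_orientation_hodgeRiemann_kaehler`, Voisin I Lemma 3.8).
[cite: Huybrechts2016K3, Ch. 1 §2.2, Prop. 3.2 and Ch. 6 Prop. 1.2 (ii)] [cite: VoisinHodgeI2002, §7.1.1, §7.1.3 Thm. 7.10 and §3.1.3 Lemma 3.8] -/
theorem IsK3Surface.exists_orientation_hodgeRiemann_ample (hS : IsK3Surface S) :
    ∃ μ : HomologicalOrientation ℤ (Motives.ComplexPoints S) (2 * 2),
      (∀ σ : HodgeTheory.complexBetti S (2 * 1), HodgeTheory.IsOfHodgeType 2 S (2 * 1) 2 0 σ →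
        σ ≠ 0 → ∀ g : singularCohomology ℤ ℤ (Motives.ComplexPoints S) (2 * 2),
          kroneckerPairing ℤ ℤ (Motives.ComplexPoints S) (2 * 2) g μ.fundamentalClass = 1 →
            ∃ c : ℂ, 0 < c.re ∧
              cupProduct (rfl : 2 * 1 + 2 * 1 = 2 * 2)
                (HodgeTheory.conjClass (Motives.ComplexPoints S) (2 * 1) σ) σ =
                  c • singularCohomology.ringChange (algebraMap ℤ ℂ) (Motives.ComplexPoints S)
                    (2 * 2) g) ∧
      ∃ u : singularCohomology ℤ ℤ (Motives.ComplexPoints S) (2 * 1),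
        HodgeTheory.IsOfHodgeType 2 S (2 * 1) 1 1
            (singularCohomology.ringChange (algebraMap ℤ ℂ) (Motives.ComplexPoints S) (2 * 1) u) ∧
          0 < kroneckerPairing ℤ ℤ (Motives.ComplexPoints S) (2 * 2)
            (cupProduct (rfl : 2 * 1 + 2 * 1 = 2 * 2) u u) μ.fundamentalClass := by
  classical
  obtain ⟨A, η, hη, hη0⟩ := hS.exists_holomorphicTwoForm_ne_zero
  have hX := hS.isSmoothProjective
  letI := hX.chartedSpace
  haveI := Motives.ComplexPoints.compactSpace_of_isSmoothProjective hX
  haveI := Motives.ComplexPoints.t2Space_of_isSmoothProjective hX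
  haveI := HodgeTheory.connectedSpace_complexPoints hX
  haveI : CompactSpace A.carrier := A.compactSpace_carrier hX
  -- the restricted Fubini–Study class on `A`, through a natural multiplicative family `e`
  obtain ⟨N, ι, hι, e, he, hem, hθ, H, r, hH, hr, hrat⟩ := fubiniStudy_rational_of_hodgeModel hX A
  -- the complex orientation
  obtain ⟨μ, hHR, hK⟩ := hS.exists_orientation_hodgeRiemann_kaehler A hη hη0 e he hem
  refine ⟨μ, hHR, ?_⟩
  -- `H` is a Kähler class, `A^* H = e[ω] ⊗ 1` for the Kähler form `ω` of a Kähler metric `gK`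
  have hKV := A.isKaehlerClassVia_of_pullback_eq_fubiniStudyPullbackForm e hX ι hθ hH
  have h11 : HodgeTheory.IsOfHodgeType 2 S 2 1 1 H := hKV.isOfHodgeType_one_one he
  obtain ⟨gK, hgK, hHg⟩ := hKV
  -- an integral class `u` with `u ⊗ 1 = (N' r) • H`
  obtain ⟨N', hN', hint⟩ :=
    HodgeTheory.exists_nsmul_isIntegralClass_of_isRationalClass_holds hX (2 * 1) ((r : ℂ) • H) hrat
  obtain ⟨u, hu⟩ := (isIntegralClass_iff_exists_ringChange_int _).1 hint
  obtain ⟨c, hc⟩ : ∃ c : ℝ, c = N' * r := ⟨_, rfl⟩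
  have hc0 : 0 < c := hc ▸ mul_pos (by exact_mod_cast hN') hr
  have hu' : singularCohomology.ringChange (algebraMap ℤ ℂ) (Motives.ComplexPoints S) (2 * 1) u = (c : ℂ) • H := by
    rw [hu, smul_smul, hc, Complex.ofReal_mul, Complex.ofReal_natCast]
  refine ⟨u, ?_, ?_⟩
  · -- `u ⊗ 1` is of type `(1,1)`
    rw [hu']
    exact h11.smul _
  · -- `⟨u ∪ u, [S(ℂ)]_μ⟩ > 0`
    haveI : WedgeFacts 𝓘(ℝ, A.model) A.carrier ℝ :=
      wedgeFacts_of_assoc 𝓘(ℝ, A.model) A.carrier ℝ (ContinuousAlternatingMap.WedgeAssoc_holds ℝ A.model ℝ)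
    set κ := gK.toRiemannianMetric.kaehlerForm with hκdef
    have hκs : IsSmoothForm κ :=
      Literature.Geometry.Kaehler.isSmoothForm_kaehlerForm_of_isManifold_complex_holds
        (E := A.model) (M := A.carrier) gK
    have hκc : κ ∈ closedSmoothForms 𝓘(ℝ, A.model) A.carrier ℝ 2 :=
      (Literature.Geometry.Kaehler.mem_closedSmoothForms_iff _).2 ⟨hκs, hgK.isClosedForm_kaehlerForm⟩
    have hκκ : κ.wedge κ ∈ closedSmoothForms 𝓘(ℝ, A.model) A.carrier ℝ (2 + 2) :=
      wedge_mem_closedSmoothForms hκc hκc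
    -- `A^* H = e[κ] ⊗ 1`, in the degree spelling `2 * 1`
    have hHg' : A.pullback (2 * 1) H =
        ofRealClass A.carrier (2 * 1) (e A.carrier (2 * 1) (deRhamCohomology.mk ⟨κ, hκc⟩)) := hHg
    -- the real class `y` with `φ^* y = e[κ ∧ κ]` is positive on `[S(ℂ)]_μ`
    have hsurjℝ : Function.Surjective (singularCohomology.map ℝ ℝ
        (⟨A.toComplexPoints, A.isAnalytification.isHomeomorph.continuous⟩ : C(A.carrier, _)) (2 * 2)) :=
      (singularCohomology.mapIso ℝ ℝ A.isAnalytification.homeomorph (2 * 2)).toLinearEquiv.surjective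
    obtain ⟨y, hy⟩ := hsurjℝ (e A.carrier (2 * 2) (deRhamCohomology.mk ⟨κ.wedge κ, hκκ⟩))
    have hypos := hK gK hgK hκκ y hy
    -- `e[κ] ∪ e[κ] = e[κ ∧ κ]` (`e` is multiplicative)
    have hcup : cupProduct (rfl : 2 * 1 + 2 * 1 = 2 * 2) (e A.carrier (2 * 1) (deRhamCohomology.mk ⟨κ, hκc⟩))
        (e A.carrier (2 * 1) (deRhamCohomology.mk ⟨κ, hκc⟩)) =
          e A.carrier (2 * 2) (deRhamCohomology.mk ⟨κ.wedge κ, hκκ⟩) := by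
      rw [← hem A.carrier (2 * 1) (2 * 1) (2 * 2) rfl, deRhamCohomology.cup_mk_mk]
      refine congrArg (fun z ↦ e A.carrier (2 * 2) (deRhamCohomology.mk z)) (Subtype.ext ?_)
      rw [deRhamCohomology.coe_closedWedge]
      funext x
      ext v
      rw [MForm.castDeg_apply]
      simp only [Fin.cast_eq_self]
    -- `φ^*(u ⊗ 1) = c • e[κ] ⊗ 1`
    have hmu : singularCohomology.map ℂ ℂ
        (⟨A.toComplexPoints, A.isAnalytification.isHomeomorph.continuous⟩ : C(A.carrier, _)) (2 * 1)
          (singularCohomology.ringChange (algebraMap ℤ ℂ) (Motives.ComplexPoints S) (2 * 1) u) =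
        (c : ℂ) • ofRealClass A.carrier (2 * 1) (e A.carrier (2 * 1) (deRhamCohomology.mk ⟨κ, hκc⟩)) := by
      have h := congrArg (A.pullback (2 * 1)) hu'
      rw [map_smul, hHg'] at h
      exact h
    -- `(u ∪ u) ⊗ ℝ = c² • y`, checked after `⊗ ℂ` and `φ^*` (both injective)
    have key : singularCohomology.ringChange (algebraMap ℤ ℝ) (Motives.ComplexPoints S) (2 * 2)
        (cupProduct (rfl : 2 * 1 + 2 * 1 = 2 * 2) u u) = (c * c) • y := by
      apply HodgeTheory.ofRealClass_injective (2 * 2)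
      have hinjC : Function.Injective (singularCohomology.map ℂ ℂ
          (⟨A.toComplexPoints, A.isAnalytification.isHomeomorph.continuous⟩ : C(A.carrier, _)) (2 * 2)) :=
        (singularCohomology.mapIso ℂ ℂ A.isAnalytification.homeomorph (2 * 2)).toLinearEquiv.injective
      apply hinjC
      rw [ofRealClass_ringChange_int, singularCohomology.ringChange_cupProduct, cupProduct_map, hmu,
        map_smul, map_smul, LinearMap.smul_apply, smul_smul, ← HodgeTheory.ofRealClass_cupProduct, hcup,
        HodgeTheory.ofRealClass_smul, map_smul, ← HodgeTheory.ofRealClass_map, hy, Complex.ofReal_mul]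
    -- conclude over `ℤ`
    have hreal : (algebraMap ℤ ℝ) (kroneckerPairing ℤ ℤ (Motives.ComplexPoints S) (2 * 2)
        (cupProduct (rfl : 2 * 1 + 2 * 1 = 2 * 2) u u) μ.fundamentalClass) =
          c * c * kroneckerPairing ℝ ℝ (Motives.ComplexPoints S) (2 * 2) y
            (singularHomology.coeffChange (Motives.ComplexPoints S)
              (algebraMap ℤ ℝ : ℤ →+* ℝ).toAddMonoidHom (2 * 2) μ.fundamentalClass) := by
      rw [← Literature.Geometry.Manifold.kroneckerPairing_ringChange_coeffChange ℝ
        (cupProduct (rfl : 2 * 1 + 2 * 1 = 2 * 2) u u) μ.fundamentalClass, key, map_smul,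
        LinearMap.smul_apply, smul_eq_mul]
    have hpos : (0 : ℝ) < algebraMap ℤ ℝ (kroneckerPairing ℤ ℤ (Motives.ComplexPoints S) (2 * 2)
        (cupProduct (rfl : 2 * 1 + 2 * 1 = 2 * 2) u u) μ.fundamentalClass) := by
      rw [hreal]
      exact mul_pos (mul_pos hc0 hc0) hypos
    rw [eq_intCast] at hpos
    exact_mod_cast hpos

/-- **The named fact reduced to its one remaining printed input, Hirzebruch's index theorem FOR THE
COMPLEX ORIENTATION.** Clauses (ii) and (iii) being proved for the complex orientation
(`IsK3Surface.exists_orientation_hodgeRiemann_ample`), which clause (ii) pins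
(`IsK3Surface.orientation_unique_of_hodgeRiemann_twoZero`), the fact
`K3_exists_orientation_signature_hodgeRiemann_ample` follows from: for every K3 surface `S` and every
`ℤ`-orientation `μ` of `S(ℂ)` with the Hodge–Riemann positivity (ii), the intersection form
`intersectionForm μ` on `H²(S(ℂ); ℤ)/tors` has index `−16` (Huybrechts Ch. 1, proof of Prop. 3.5,
p. 24: Thom–Hirzebruch `τ = (c₁² − 2c₂)/3 = −16`; Milnor–Stasheff Thm. 19.4; equivalently Hodge index
with `b₂ = 22`, Voisin I Thm. 6.33). That input is not in the tree (no signature theorem, no Hodge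
index theorem with sign, `b₂ = 22` = the sibling fact `K3_finrank_complexBetti_two`); this is the
reduction, not the discharge. [cite: Huybrechts2016K3, Ch. 1 Prop. 3.5, proof (p. 24)]
[cite: MilnorStasheff1974, §19 Thm. 19.4 and §13 p. 151] [cite: VoisinHodgeI2002, §6.3.2 Thm. 6.33] -/
theorem K3_exists_orientation_signature_hodgeRiemann_ample_of_signature
    (h : ∀ (S : Motives.SchemeOver ℂ), IsK3Surface S →
      ∀ μ : HomologicalOrientation ℤ (Motives.ComplexPoints S) (2 * 2),
        (∀ σ : HodgeTheory.complexBetti S (2 * 1), HodgeTheory.IsOfHodgeType 2 S (2 * 1) 2 0 σ →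
        σ ≠ 0 → ∀ g : singularCohomology ℤ ℤ (Motives.ComplexPoints S) (2 * 2),
          kroneckerPairing ℤ ℤ (Motives.ComplexPoints S) (2 * 2) g μ.fundamentalClass = 1 →
            ∃ c : ℂ, 0 < c.re ∧
              cupProduct (rfl : 2 * 1 + 2 * 1 = 2 * 2)
                (HodgeTheory.conjClass (Motives.ComplexPoints S) (2 * 1) σ) σ =
                  c • singularCohomology.ringChange (algebraMap ℤ ℂ) (Motives.ComplexPoints S)
                    (2 * 2) g) →
        (intersectionForm (rfl : 2 * 1 + 2 * 1 = 2 * 2) μ).signature = -16) :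
    K3_exists_orientation_signature_hodgeRiemann_ample := by
  intro S hS
  obtain ⟨μ, hμ, hamp⟩ := hS.exists_orientation_hodgeRiemann_ample
  exact ⟨μ, h S hS μ hμ, hμ, hamp⟩

end K3

end Literature.AlgebraicGeometry.Surfaces

end
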